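/-
Copyright (c) 2026. All rights reserved.
Released under Apache 2.0 license as described in the file LICENSE.
-/
import Literature.MathematicalPhysics.QuantumFieldTheory.Balaban1983to89.B4Green244
import Literature.MathematicalPhysics.QuantumFieldTheory.Balaban1983to89.B4Reflection242

/-!
# `Balaban1983to89.B4Green242Bridge` — B4 Lemma 2.4 (2.35), both quantities, and (2.36) for `G_j(□)Q_j^*`: the two
audited lineages joined (the dictionaries `opD ↔ opK`, `n·(K(·+e_μ) − K) ↔ GD` and
`(n/|σ|_∞)^α·n·[(K(·+σ+e_μ) − K(·+σ)) − (K(·+e_μ) − K)] ↔ GH`), and the existence of the box propagator (nothing of B4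
asserted)

Source under audit (cell pub-balaban): T. Bałaban, *Regularity and decay of lattice Green's functions*, Commun. Math.
Phys. **89** (1983) 571–597 [`Balaban1983RegularityDecay`, "B4"], p. 582 [PDF 12] Lemma 2.4 (2.35) and p. 584
[PDF 14] (2.42)/(2.44), with p. 573 [PDF 3] (the difference derivative), p. 585 [PDF 15] (2.48)–(2.49) and p. 586
[PDF 16] (2.50)–(2.51) (journal page = PDF page + 570; renders
`b2b-balaban-ref1/pages/1983-cmp89-regularity-decay/1983-cmp89-regularity-decay-p012-x2.png`, `-p014-x2.png`,
`-p003-x2.png`, `-p015-x2.png`, `-p016-x2.png`, read as images; crops `b2b-balaban-pv13-g4/crops/crop_b4p582_lemma24.png`,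
`crop_b4p584_top.png`).

## WHAT IS PRINTED (verbatim; `≦` of the print written `≤`)

p. 582: «Lemma 2.4. There exist positive constants c₀, δ₀, and for α<1, there exists a constant c₁, such that
|(G_j(□)Q_j^*)(x, y)|, |(∂_μ^{L^{−j}} G_j(□)Q_j^*)(x, y)| ≤ c₀e^{−δ₀|x−y|},   (2.35)
(1/|x−x′|^α) |(∂_μ^{L^{−j}} G_j(□)Q_j^*)(x, y) − (∂_μ^{L^{−j}} G_j(□)Q_j^*)(x′, y)| ≤ c₁e^{−δ₀ dist({x,x′},y)},   (2.36)
|C^{(j)}(□; y, y′)| ≤ c₀e^{−δ₀|y−y′|},   (2.37)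
for arbitrary non-negative integer j, arbitrary, rectangular parallelepiped □ ⊂ L^{−j}Z^d built of large blocks, and
x, x′ ∈ □, y, y′ ∈ □^{(j)} = □∩Z^d.»

p. 584: «The proof of (2.35), (2.36) can be reduced again to a simpler case. This part of the argument is valid for an
arbitrary rectangular parallelepiped □ built of unit blocks, so the inequalities are valid for all such sets. Let us
denote ξ = L^{−j}. We represent G_j(□) with the help of the propagator G_j with free boundary conditions on ξZ^d using
the multiple reflection method. If □ is written as □ = {x∈ξZ^d : 0 ≤ x_μ ≤ M_μ, μ = 1,…,d}, then
G_j(□; x, x′) = G_j(x, x′) + Σ_{μ=1}^d G_j(x, (x′_1,…,−x′_μ−ξ,…,x′_d)) + Σ_{μ=1}^d G_j(x, (x′_1,…,2M_μ−ξ−x′_μ,…,x′_d))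
+ … .   (2.42)
Using this representation it is enough to prove (2.35), (2.36) for the propagator G_j.» … «We apply it to the basic
equation (−Δ^ξ + m_j² + a_jQ_j^*Q_j)φ₀ = f.   (2.44)»

p. 573: «[Of course ∂^η_μ is a difference derivative defined by (∂^η_μ A)(x) = η^{−1}(A(x+ηe_μ) − A(x)).]»

p. 585, before (2.49): «We are now ready to prove the inequalities (2.35), (2.36); for example, let us take the
expression on the left hand side of (2.36):»; (2.49) equates «(1/|x−x′|^α)((∂^ξ_μ G_jQ_j^*)(x, y) − (∂^ξ_μ G_jQ_j^*)(x′, y))»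
with «(2π)^{−d} ∫_{|p′|≤π} dp′» of the `l`-sum whose `l`-th term carries the numerator
«(1/|x−x′|^α)(e^{i(p′+l)·(x−x′)} − 1)e^{i(p′+l)(x′−y)}» and the factor «∂^ξ_μ(p′+l)u_j(p′+l)Δ¹(p′)/Δ^ξ(p′+l)»; after
(2.49): «where Δ¹(p′) = Σ_{μ=1}^{d} |e^{−ip′_μ} − 1|² + m_j², ∂^ξ_μ(p) = (e^{iξp_μ} − 1)/ξ, and we have assumed that
|x′−y| ≤ |x−y|. It is easy to prove that the underintegral expression is bounded because» … (last displayed line of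
p. 585) «(1/|x−x′|^α)|e^{i(p′+l)·(x−x′)} − 1| ≤ O(1)|p′+l|^α,».

p. 586, end of (2.51): «≤ O(1), the constant depends on α<1.   (2.51)»; then: «The expression is a function of p′ and
can be extended as an analytic function to some neighbourhood of [−π, π]^d. It is more troublesome, but equally
elementary, to prove that this neighbourhood can be chosen independently of j and that the expression is bounded also
in this neighbourhood. Shifting the domain of integration in (2.49) into a complex domain in the direction of the
vector x′−y, we can bound the left hand side of (2.49) by a constant depending on α multiplied by the exponential
factor e^{−δ₀|x′−y|} = e^{−δ₀dist({x,x′},y)}. We get the inequality (2.36). The inequalities (2.35) are proved in the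
same way and constants depend on d only. Thus we have proved Lemma 2.4, hence also theTheorem.» (sic).

Both quantities of (2.35) FOR `G_j(□)Q_j^*` — `|(G_j(□)Q_j^*)(x, y)|` (§1–§4) and `|(∂_μ^{L^{−j}} G_j(□)Q_j^*)(x, y)|`
(§5) — and the Hölder quotient (2.36) FOR `G_j(□)Q_j^*` (§6) are the subject of this file (gauge field `A = 0`, the case
of Sect. 2); (2.37) is not.  The image
sum «+ …» of (2.42) is parametrised in `B4Reflection242` by `(ε, m) ∈ Bool^{d+1} × ℤ^{d+1}` (`reflBox`, `printedImages`);
that parametrisation is the typist's, not the print's.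

## WHAT THIS FILE CERTIFIES (kernel-checked; the two lineages are USED, not re-proved)

* b04 lineage (`B4Green244`, tree): the position-space kernel `K n a m2 z y` of (2.48) SOLVES the basic equation
  (2.44) with right-hand side `Q_j^*δ_y` on the whole fine lattice — `green244 : opD n a m2 (K · y) z = 1_{⌊z/n⌋ = y}`
  — and DECAYS at unit rate uniformly in `n = L^j`, `a ∈ [a₋,a₊]`, `m² ∈ [0,m²₊]` — `K_decay`; and the lattice kernel
  of the DIFFERENTIATED multiplier `GD n a m2 τ μ` of (2.49) (`B4StripSumsDeriv.GD`, the `l`-th term of (2.48) times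
  `∂^ξ_μ(p′+l)`) decays uniformly as well — `B4StripSumsDeriv.dkernel248_decay`; and so does, for `0 ≤ α < 1` and fine
  displacements `0 < |σ|_∞ ≤ n`, the lattice kernel of the HÖLDER multiplier `GH α n a m2 τ μ σ` of (2.49)
  (`B4StripSumsHolder.GH`, the `l`-th term of `GD` times `PhZ n k σ − 1` = «e^{i(p′+l)·(x−x′)} − 1», weighted by
  `(n/|σ|_∞)^α` = «1/|x−x′|^α» in the sup norm) — `B4StripSumsHolder.hkernel248_decay` (the contour shift of p. 586
  with the bound (2.51), «the constant depends on α<1»).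
* pv17 lineage (`B4Reflection242` §9, tree): for ANY kernel with these two properties written in KERNEL FORM
  ((α) `Σ_{z ∈ opSupp b u} opK c₁ msq a b u z · K z y = 1_{blk u = y}`, (β′) `‖K u y‖ ≤ M_K e^{−κ₀|blk u − y|_∞}`)
  and ANY inverse `GB` of the NEUMANN box operator, the block sums `Σ_{x′ ∈ □, blk x′ = y} GB(x,x′)` — which are
  `(G_j(□)Q_j^*)(x,y)` in the printed convention (unit-lattice, unweighted sum in `y`; XREAD C-pv13g4-4 (b)) — obey
  (2.35) with constants uniform in the box (`greenBoxQ_decay_src`, the method of images (2.42) put on the source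
  variable); and, given in addition (γ) one-sided first-difference decay `‖K(u ± e_μ, y) − K(u, y)‖ ≤ M₁e^{−κ₀|blk u − y|_∞}`,
  so do the first differences `Σ_{x′ ∈ □, blk x′ = y} (GB(x+e_μ,x′) − GB(x,x′))` (`greenBoxQ_deriv_decay_src`).
* THIS FILE, §1–§3 (v1): the finite-sum DICTIONARY between b04's operator `opD n a m2` (acting on functions,
  `= n²(−Δ) + m² + a·(block average)`) and pv17's kernel `opK (n²) m² (a·n^{−(d+1)}) n` (`opK_dictionary`; block
  label `blk = coarse` by `rfl`, block `blockOf n x = {finePt n (blk n x) j}`; here `d+1` is the lattice dimension),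
  hence (α) for b04's `K` from `green244` (`green244_kernelForm`), and the assembled display `greenBoxQ_decay_235`:
  THERE EXIST `κ > 0`, `C ≥ 0` (depending on `d`, `a₋ > 0`, `a₊`, `m²₊` only) such that for every `n = L^j ≥ 1`, every
  box `□ = Π_μ [0, n·M_μ)` of fine sites (`M_μ ≥ 1` unit blocks), every `a ∈ [a₋,a₊]`, `m² ∈ [0,m²₊]` and every
  inverse `GB` of the Neumann box operator `n²(−Δ^N_□) + m² + a·Q^*Q`:
  `‖Σ_{x′ ∈ □, blk x′ = y} GB(x,x′)‖ ≤ C e^{−κ|blk x − y|_∞}` for all `x ∈ □`, `y ∈ Π_μ[0,M_μ)` — Lemma 2.4 (2.35),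
  FIRST QUANTITY FOR `G_j(□)Q_j^*`, with the sole remaining hypothesis that an inverse `GB` is given.
* THIS FILE, §4 (v2): EXISTENCE OF THE BOX PROPAGATOR.  For real `c₁ > 0`, `msq ≥ 0`, `a > 0`, any block side `b`
  and any box `Π_μ [0,N_μ)` with `N_μ ≥ 1`, the Neumann box operator `c₁(−Δ^N_□) + msq + a·𝟙[same block, in □]`
  (the matrix `opBox c₁ msq a b N := Matrix.of (opBoxK c₁ msq a b N · ·)` on `↥(boxDom N)`) has injective `mulVec`
  (`opBox_mulVec`, `opBox_mulVec_injective`): its Hermitian form is `c₁·½Σ_{x∼y in □}|v x − v y|² + msq·Σ|v x|²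
  + a·Σ_β |Σ_{blk x = β} v x|²` (`two_mul_lapForm`, `avgForm_eq`, `quadForm_eq`), so a null vector is constant along
  box bonds (`box_const_of_bonds`: the box graph is connected — descend the coordinate sum), hence constant, and its
  own block sum kills the constant.  Therefore the matrix is a unit and `A * A⁻¹ = 1` (`opBox_isUnit`,
  `opBox_mul_inv`; Mathlib `Matrix.mulVec_injective_iff_isUnit`), in particular for the box operator of (2.44) in
  lattice units, `boxOp n a m2 M := opBox (n²) (m²) (a·n^{−(d+1)}) n (n·M)` (`boxOp_mul_inv`), and the HYPOTHESIS-FREE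
  display `greenBoxQ_decay_235_inv`: the v1 display with `GB := (boxOp n a m2 M)⁻¹`, every link a tree theorem
  (`green244`, `K_decay`, `greenBoxQ_decay_src`, `boxOp_mul_inv`).  Folklore finite-dimensional linear algebra; B4
  takes the existence of `G_j(□)` for granted (p. 582 «the operators G_j^η(□)Q_j^*»), so nothing printed is at stake
  in §4 — it only removes the last binder of the certificate.
* THIS FILE, §5 (v3): THE DERIVATIVE DICTIONARY AND (2.35), SECOND QUANTITY, FOR `G_j(□)Q_j^*`.  The differentiated full
  multiplier `GDfull n a m2 z μ` (the `l`-sum of (2.48) at the fine point `z`, `l`-th term times `∂^ξ_μ(p′+l)`,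
  `ξ = 1/n`; `B4StripSumsDeriv.D`) satisfies `Gfull(z+e_μ) − Gfull(z) = n⁻¹·GDfull(z; μ)` (`Gfull_add_e_sub`, from
  `B4Green244.PhZ_add_e`: «e^{iξp_μ} − 1 = ξ·∂^ξ_μ(p)») and `GDfull(n x⁰ + τ; μ) = e^{ip′·x⁰}·GD n a m2 τ μ`
  (`GDfull_finePt`); hence, by linearity and phase translation of the lattice kernel, THE IDENTIFICATION
  `K(z + e_μ, y) − K(z, y) = n⁻¹ · latticeKernel (GD n a m2 (z mod n) μ) (⌊z/n⌋ − y)` (`K_add_e_sub`) — the reading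
  «(∂^ξ_μ G_jQ_j^*)(x,y) = (2π)^{-d}∫ GD(p′)e^{ip′·(x⁰−y)}dp′» stated in `B4StripSumsDeriv`'s docstrings, now a theorem —
  and from `dkernel248_decay` the uniform one-sided first-difference decay of `K` in both directions `± e_μ`
  (`K_deriv_decay`; the backward step is the forward step at `z − e_μ`, whose block label is within sup-distance `1`,
  `supNorm_coarse_add_e_sub_le`), i.e. hypothesis (γ) of `greenBoxQ_deriv_decay_src` for b04's `K`; and the assembled
  displays `greenBoxQ_deriv_decay_235` (any inverse `GB`) / `greenBoxQ_deriv_decay_235_inv` (`GB := boxOp⁻¹`, §4):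
  THERE EXIST `κ > 0`, `C ≥ 0` (depending on `d`, `a₋ > 0`, `a₊`, `m²₊` only) such that for every `n = L^j ≥ 1`, box,
  window, direction `μ`, fine box points `x`, `x + e_μ ∈ □` and `y ∈ Π_ν[0,M_ν)`:
  `‖n·Σ_{x′ ∈ □, blk x′ = y} (GB(x+e_μ,x′) − GB(x,x′))‖ ≤ C e^{−κ|blk x − y|_∞}` — Lemma 2.4 (2.35), SECOND QUANTITY
  `|(∂_μ^{L^{−j}} G_j(□)Q_j^*)(x,y)| ≤ c₀e^{−δ₀|x−y|}` FOR `G_j(□)Q_j^*`, every link a tree theorem (`green244`, `K_decay`,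
  `dkernel248_decay`, `greenBoxQ_deriv_decay_src`, `boxOp_mul_inv`).  Finite-sum and Bochner-linearity bookkeeping
  only; the analytic content stays in the two lineages.
* THIS FILE, §6 (v4): THE HÖLDER DICTIONARY AND (2.36) FOR `G_j(□)Q_j^*`.  The Hölder-difference full multiplier
  `GHfull n a m2 z μ σ` (the `l`-sum of (2.49) at the fine base point `z` and fine displacement `σ`, `x′ − x = ξσ`,
  without the weight) satisfies `GDfull(z+σ; μ) − GDfull(z; μ) = GHfull(z; μ; σ)` (`GDfull_add_sub`, from `PhZ_add`:
  «e^{i(p′+l)·ξ(z+σ)} − e^{i(p′+l)·ξz} = (e^{i(p′+l)·ξσ} − 1)e^{i(p′+l)·ξz}») and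
  `(n/|σ|_∞)^α·GHfull(n x⁰ + τ; μ; σ) = e^{ip′·x⁰}·GH α n a m2 τ μ σ` (`GHfull_finePt`, `GH_scaled_finePt`); hence, by
  linearity and phase translation of the lattice kernel (the multiplier `GDfull` is holomorphic on the zone,
  `differentiableAt_GDfull`, so its integrand is integrable), THE HÖLDER IDENTIFICATION
  `(n/|σ|_∞)^α·n·[(K(z+σ+e_μ,y) − K(z+σ,y)) − (K(z+e_μ,y) − K(z,y))] = latticeKernel (GH α n a m2 (z mod n) μ σ) (⌊z/n⌋ − y)`
  (`K_holder_dd`) — the DICTIONARY sentence of `B4StripSumsHolder.GH`'s docstring, now a theorem — and from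
  `hkernel248_decay` the uniform weighted second-difference decay of `K` for `σ ≠ 0`, `|σ_ν| ≤ n`, both steps `± e_μ`
  (`K_holder_decay`); the IMAGES TRANSFER for a second difference (`greenBoxQ_holder_src`: an image map `σ_{ε,m}`
  carries the pair `x, x + v` to `σx, σx + sflip ε v` — `reflBox_sub` — and `|sflip ε v|_∞ = |v|_∞`, `supNorm_sflip`, so
  the weight is the same for every image; the series is majorised image by image by `tsum_srcMajorant_unif`); and the
  assembled displays `greenBoxQ_holder_decay_236` (any inverse `GB`) / `greenBoxQ_holder_decay_236_inv`
  (`GB := boxOp⁻¹`, §4): FOR `0 ≤ α < 1` THERE EXIST `κ > 0`, `C ≥ 0` (depending on `d`, `a₋ > 0`, `a₊`, `m²₊`, `α`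
  only) such that for every `n = L^j ≥ 1`, box, window, direction `μ`, fine box points `x, x + e_μ, x′, x′ + e_μ ∈ □`
  with `x′ ≠ x`, and `y ∈ Π_ν[0,M_ν)`:
  `(n/|x′−x|_∞)^α·‖n·Σ_{x″ ∈ □, blk x″ = y} [(GB(x′+e_μ,x″) − GB(x′,x″)) − (GB(x+e_μ,x″) − GB(x,x″))]‖
  ≤ C e^{−κ·min(|blk x − y|_∞, |blk x′ − y|_∞)}` — Lemma 2.4 (2.36)
  `(1/|x−x′|^α)|(∂_μ^{L^{−j}} G_j(□)Q_j^*)(x,y) − (∂_μ^{L^{−j}} G_j(□)Q_j^*)(x′,y)| ≤ c₁e^{−δ₀dist({x,x′},y)}` FOR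
  `G_j(□)Q_j^*`, every link a tree theorem (`green244`, `K_decay`, `hkernel248_decay`, `dkernel248_decay`,
  `greenBoxQ_srcImages`, `tsum_srcMajorant_unif`, `boxOp_mul_inv`).  Near pairs (`|x′−x|_∞ ≤ n`, i.e. `|x−x′| ≤ 1`
  in lattice units) go through the Hölder kernel bound and the images; far pairs (`|x′−x|_∞ > n`, weight `≤ 1`)
  through (2.35), second quantity, at `x` and at `x′` separately (`greenBoxQ_deriv_decay_235`) — the remark «separations
  |x−x′|_∞ > 1 … follow from (2.35) … by the triangle inequality» of `hkernel248_decay`'s docstring, carried out.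
  Finite-sum and Bochner-linearity bookkeeping only; the analytic content stays in the two lineages.

## SCOPE / NOT CERTIFIED

* the second quantity of (2.35) and the Hölder quotient (2.36) are certified for pairs `x`, `x + e_μ` (and `x′`,
  `x′ + e_μ`) ALL in the box (the forward step; the backward step at `x` is the forward step at `x − e_μ`) — nothing is
  said about a difference across the far face of `□`; in (2.36) the distance `|x − x′|` is read in the SUP NORM of the
  fine lattice (`|x′ − x|_∞/n` in lattice units; the Euclidean weight differs by a factor in `[1, (d+1)^{α/2}]`, a
  change of `c₁` only) and `dist({x,x′},y)` is read at BLOCK resolution in the sup norm, as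
  `min(|blk x − y|_∞, |blk x′ − y|_∞)` (`x`, `x′` located by their unit blocks; the conversion to the printed Euclidean
  `e^{−δ₀dist({x,x′},y)}` — `|u|_2 ≤ √(d+1)·|u|_∞`, `|x − blk x|_∞ < 1` in lattice units, so `δ₀ = κ/√(d+1)` and a
  factor `e^{κ}` in `c₁` — is NOT typed here); no value of B4's `c₁`, `δ₀` is asserted;
* the intermediate bounds «(2.35), (2.36) for the propagator G_j» (p. 584, the free fine-lattice propagator) typed in
  `B4Reflection242` §3–§7 keep their fine-`G_j` hypotheses (i)/(iii) there; this file does not touch them;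
* boxes anchored at the origin (translation covariance not typed); no value of B4's `c₀, δ₀` is asserted; nothing here
  is summit progress.

## REVISION LOG

* v1 (p180249, commit 459177699072, b2b-balaban-pv17-g3): §1–§3, 12 declarations.
* v2 (p180927, commit 8b198d00c361, b2b-balaban-pv17-g4): DOCFIX G-pv13g4-2 (XREAD by b2b-balaban-pv13-g4, certificate
  `b2b-balaban-pv13-g4/XREAD-B4Green242Bridge.md`): the v1 header block «WHAT IS PRINTED» misquoted p. 582 Lemma 2.4
  (unprinted words «depending on d only», four quantities in (2.35) instead of the printed two) and spliced the first
  sentence of p. 584; both replaced above by the printed text read from the renders; SCOPE bullet on «plain G_j(□)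
  quantities» reworded (there are none in print; meant: the bounds for the free propagator G_j).  Docstring-only with
  respect to v1's 12 declarations (unchanged, same order); APPEND-ONLY new §4 (existence of the box propagator and the
  hypothesis-free display).
* v3 (p181130, commit 736d5cc72861, b2b-balaban-pv17-g4): APPEND-ONLY new §5 (the derivative dictionary `K_add_e_sub`,
  `K_deriv_decay`, and (2.35) second quantity for `G_j(□)Q_j^*`, `greenBoxQ_deriv_decay_235(_inv)`); v1/v2 declarations unchanged (same
  order, bodies byte-identical); header: title, source lines (p. 573, p. 585 renders), «WHAT IS PRINTED» (p. 573 and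
  p. 585 quotations added; scope sentence now names both quantities), the b04 / pv17 lineage bullets extended by their
  derivative halves, the §5 bullet, and the first SCOPE bullet (formerly: second quantity not certified) replaced.
  Imports unchanged (`B4StripSumsDeriv` is already in the import closure of `B4Green244` via `B4StripSumsHolder`).
* v4 (this file, b2b-balaban-pv17-g5): APPEND-ONLY new §6 (the Hölder dictionary `PhZ_add`, `GHfull`, `GDfull_add_sub`,
  `GHfull_finePt`, `GH_scaled_finePt`, `GDfull_eq_mul_sub`, `differentiableAt_GDfull`, `K_add_e_sub_GDfull`,
  `K_holder_dd`, `K_holder_decay`; the sign-flip lemmas `supNorm_sflip`, `abs_sflip_apply`, `sflip_zero`,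
  `sflip_ne_zero`; the second-difference images transfer `greenBoxQ_holder_src`; the constant `C236`; and (2.36) for
  `G_j(□)Q_j^*`, `greenBoxQ_holder_decay_236(_inv)`); v1–v3 declarations unchanged (same order, bodies byte-identical);
  header: title, source lines (p. 586 render), «WHAT IS PRINTED» (p. 585 and p. 586 quotations added; scope sentence
  now names (2.36)), the b04 lineage bullet extended by its Hölder half, the §6 bullet, the first SCOPE bullet
  (formerly: (2.36) not typed) replaced, the v3 log line given its proposal id.  Imports unchanged.
-/


namespace Literature.MathematicalPhysics.QuantumFieldTheory.Balaban1983to89.B4Green242Bridge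

open Finset
open Literature.MathematicalPhysics.QuantumFieldTheory.Balaban1983to89.B4ContourShift
open Literature.MathematicalPhysics.QuantumFieldTheory.Balaban1983to89.B4Reflection242

noncomputable section

variable {d : ℕ}

/-! ### §1 Evaluation of the kernel form of the operator -/

/-- the sum over the nearest neighbours: `Σ_{z ∈ nbrs x} φ z = Σ_μ φ(x + e_μ) + Σ_μ φ(x − e_μ)`. [folklore] -/
theorem sum_nbrs (φ : (Fin (d + 1) → ℤ) → ℂ) (x : Fin (d + 1) → ℤ) :
    ∑ z ∈ nbrs x, φ z = ∑ μ, φ (x + Pi.single μ 1) + ∑ μ, φ (x - Pi.single μ 1) := by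
  classical
  have hinj₁ : Function.Injective fun i : Fin (d + 1) => x + Pi.single i (1 : ℤ) := by
    intro i j h
    by_contra hij
    have := congrFun h i
    simp [hij] at this
  have hinj₂ : Function.Injective fun i : Fin (d + 1) => x - Pi.single i (1 : ℤ) := by
    intro i j h
    by_contra hij
    have := congrFun h i
    simp [hij] at this
  have hdisj : Disjoint (Finset.univ.image fun i => x + Pi.single i (1 : ℤ))
      (Finset.univ.image fun i => x - Pi.single i (1 : ℤ)) := by
    rw [Finset.disjoint_left]
    intro z hz hz'
    simp only [Finset.mem_image, Finset.mem_univ, true_and] at hz hz'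
    obtain ⟨i, rfl⟩ := hz
    obtain ⟨j, hj⟩ := hz'
    have := congrFun hj i
    by_cases hij : j = i
    · subst hij; simp at this; omega
    · simp [Ne.symm hij] at this
  unfold nbrs
  rw [Finset.sum_union hdisj, Finset.sum_image hinj₁.injOn, Finset.sum_image hinj₂.injOn]

/-- the Laplacian part: `Σ_{z ∈ opSupp b x} lapK x z · φ z = Σ_μ (2φ(x) − φ(x+e_μ) − φ(x−e_μ))`. [folklore] -/
theorem sum_opSupp_lapK_mul {b : ℕ} (φ : (Fin (d + 1) → ℤ) → ℂ) (x : Fin (d + 1) → ℤ) :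
    ∑ z ∈ opSupp b x, (lapK x z : ℂ) * φ z = ∑ μ, (2 * φ x - φ (x + Pi.single μ 1) - φ (x - Pi.single μ 1)) := by
  classical
  -- restrict to `insert x (nbrs x)`, where `lapK(x,·)` lives
  have hsub : insert x (nbrs x) ⊆ opSupp b x := Finset.subset_union_left
  rw [← Finset.sum_subset hsub (fun z _ hz' => by
    have hzx : z ≠ x := fun h => hz' (h ▸ Finset.mem_insert_self _ _)
    have hzn : z ∉ nbrs x := fun h => hz' (Finset.mem_insert_of_mem h)
    simp [lapK, hzx, hzn])]
  rw [Finset.sum_insert (not_mem_nbrs_self x)]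
  have hnb : ∑ z ∈ nbrs x, (lapK x z : ℂ) * φ z = -∑ z ∈ nbrs x, φ z := by
    rw [← Finset.sum_neg_distrib]
    refine Finset.sum_congr rfl fun z hz => ?_
    have hzx : z ≠ x := fun h => not_mem_nbrs_self x (h ▸ hz)
    simp [lapK, hzx, hz]
  rw [hnb, sum_nbrs]
  simp only [lapK, if_true, Finset.sum_sub_distrib, Finset.sum_const, Finset.card_univ, Fintype.card_fin,
    nsmul_eq_mul]
  push_cast
  ring

/-- the diagonal part: `Σ_{z ∈ opSupp b x} diagK msq x z · φ z = msq · φ x`. [folklore] -/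
theorem sum_opSupp_diagK_mul {b : ℕ} (msq : ℂ) (φ : (Fin (d + 1) → ℤ) → ℂ) (x : Fin (d + 1) → ℤ) :
    ∑ z ∈ opSupp b x, diagK msq x z * φ z = msq * φ x := by
  classical
  have hx : x ∈ opSupp b x := Finset.mem_union_left _ (Finset.mem_insert_self _ _)
  simp only [diagK, ite_mul, zero_mul, Finset.sum_ite_eq' (opSupp b x) x, if_pos hx]

/-- the block-averaging part: `Σ_{z ∈ opSupp b x} avgK a b x z · φ z = a · Σ_{z ∈ B(x)} φ z`. [folklore] -/
theorem sum_opSupp_avgK_mul {b : ℕ} (hb : 1 ≤ b) (a : ℂ) (φ : (Fin (d + 1) → ℤ) → ℂ) (x : Fin (d + 1) → ℤ) :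
    ∑ z ∈ opSupp b x, avgK a b x z * φ z = a * ∑ z ∈ blockOf b x, φ z := by
  classical
  have hsub : blockOf b x ⊆ opSupp b x := Finset.subset_union_right
  rw [Finset.mul_sum, ← Finset.sum_subset hsub (fun z _ hz' => by
    have hblk : blk b z ≠ blk b x := fun h => hz' ((mem_blockOf hb).2 h)
    simp [avgK, hblk])]
  refine Finset.sum_congr rfl fun z hz => ?_
  rw [avgK, if_pos ((mem_blockOf hb).1 hz)]

/-- **EVALUATION OF THE KERNEL FORM**: `Σ_{z ∈ opSupp b x} opK c₁ msq a b x z · φ z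
= c₁ Σ_μ (2φ(x) − φ(x+e_μ) − φ(x−e_μ)) + msq φ(x) + a Σ_{z ∈ B(x)} φ(z)` — the operator `c₁(−Δ) + msq + a·𝟙[same block]`
applied to `φ` at `x`. [cite: Balaban1983RegularityDecay, p. 584 (2.44), dictionary] [folklore] -/
theorem sum_opSupp_opK_mul {b : ℕ} (hb : 1 ≤ b) (c₁ msq a : ℂ) (φ : (Fin (d + 1) → ℤ) → ℂ) (x : Fin (d + 1) → ℤ) :
    ∑ z ∈ opSupp b x, opK c₁ msq a b x z * φ z
      = c₁ * ∑ μ, (2 * φ x - φ (x + Pi.single μ 1) - φ (x - Pi.single μ 1)) + msq * φ x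
        + a * ∑ z ∈ blockOf b x, φ z := by
  simp only [opK, add_mul, mul_assoc, Finset.sum_add_distrib, ← Finset.mul_sum]
  rw [sum_opSupp_lapK_mul, sum_opSupp_diagK_mul, sum_opSupp_avgK_mul hb]
  ring

/-! ### §2 The dictionary with `B4Green244` -/

/-- the block label of pv17 (`blk`) IS the block label of b04 (`coarse`). [folklore] -/
theorem blk_eq_coarse (b : ℕ) (x : Fin (d + 1) → ℤ) : blk b x = B4Green244.coarse b x := rfl

/-- the block as an indexed family: `Σ_{z ∈ B(x)} φ z = Σ_{j ∈ {0..n-1}^{d+1}} φ(n·blk x + j)`. [folklore] -/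
theorem sum_blockOf_eq_sum_finePt (n : ℕ) [NeZero n] (hn : 1 ≤ n) (φ : (Fin (d + 1) → ℤ) → ℂ) (x : Fin (d + 1) → ℤ) :
    ∑ z ∈ blockOf n x, φ z = ∑ j : Fin (d + 1) → Fin n, φ (B4Green244.finePt n (blk n x) j) := by
  classical
  symm
  refine Finset.sum_bij (fun j _ => B4Green244.finePt n (blk n x) j) (fun j _ => ?_) (fun j₁ _ j₂ _ h => ?_)
    (fun z hz => ?_) (fun _ _ => rfl)
  · rw [mem_blockOf hn, blk_eq_coarse, blk_eq_coarse]
    exact B4Green244.coarse_finePt n _ j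
  · funext ν
    have h1 := congrFun h ν
    simp only [B4Green244.finePt, add_right_inj, Nat.cast_inj] at h1
    exact Fin.ext h1
  · refine ⟨B4Green244.offset n z, Finset.mem_univ _, ?_⟩
    rw [← (mem_blockOf hn).1 hz, blk_eq_coarse]
    exact B4Green244.finePt_coarse_offset n z

/-- **THE DICTIONARY**: pv17's kernel `opK (n²) m² (a·n^{−(d+1)}) n` applied to `φ` is b04's operator `opD n a m²`
of (2.44) (`n²(−Δ)φ + m²φ + a·(block average of φ)`). [cite: Balaban1983RegularityDecay, p. 584 (2.44), dictionary] -/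
theorem opK_dictionary (n : ℕ) [NeZero n] (hn : 1 ≤ n) (a m2 : ℝ) (φ : (Fin (d + 1) → ℤ) → ℂ) (x : Fin (d + 1) → ℤ) :
    ∑ z ∈ opSupp n x, opK ((n : ℂ) ^ 2) (m2 : ℂ) ((a : ℂ) * ((n : ℂ) ^ (d + 1))⁻¹) n x z * φ z
      = B4Green244.opD n a m2 φ x := by
  rw [sum_opSupp_opK_mul hn, sum_blockOf_eq_sum_finePt n hn, B4Green244.opD, B4Green244.negLap, B4Green244.blockAvg,
    ← blk_eq_coarse]
  simp only [B4Green244.e]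
  ring

/-- **(α) FOR THE KERNEL OF (2.48)** — `green244` in kernel form: for `n = L^j ≥ 1`, `a > 0`, `m² ≥ 0`,
`Σ_{z ∈ opSupp n u} opK (n²) m² (a·n^{−(d+1)}) n u z · K(z,y) = 1_{blk u = y}` for all fine `u` and unit labels `y` —
hypothesis (α) of `B4Reflection242.opBox_mul_srcImages` / `greenBoxQ_decay_src`, DISCHARGED by the b04 lineage.
[cite: Balaban1983RegularityDecay, p. 584 (2.44) with p. 585 (2.48)] -/
theorem green244_kernelForm (n : ℕ) [NeZero n] (hn : 1 ≤ n) (a m2 : ℝ) (ha : 0 < a) (hm : 0 ≤ m2)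
    (u y : Fin (d + 1) → ℤ) :
    ∑ z ∈ opSupp n u, opK ((n : ℂ) ^ 2) (m2 : ℂ) ((a : ℂ) * ((n : ℂ) ^ (d + 1))⁻¹) n u z * B4Green244.K n a m2 z y
      = if blk n u = y then 1 else 0 := by
  rw [opK_dictionary n hn a m2 (fun z => B4Green244.K n a m2 z y) u, B4Green244.green244 n hn a m2 ha hm u y,
    blk_eq_coarse]

/-! ### §3 Lemma 2.4 (2.35), first quantity, for `G_j(□)Q_j^*` -/

/-- the uniform constant of the display. [folklore] -/
def C235 (d : ℕ) (κ₀ MK : ℝ) : ℝ := MK * (2 ^ (d + 1) * (1 + 2 / (1 - Real.exp (-(2 * (κ₀ / (d + 1)))))) ^ (d + 1))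

/-- the uniform constant is non-negative. [folklore] -/
theorem C235_nonneg (d : ℕ) {κ₀ MK : ℝ} (hκ₀ : 0 < κ₀) (hMK : 0 ≤ MK) : 0 ≤ C235 d κ₀ MK := by
  unfold C235
  have h1 : 0 < 1 - Real.exp (-(2 * (κ₀ / (d + 1)))) := by
    have : Real.exp (-(2 * (κ₀ / (d + 1)))) < 1 := Real.exp_lt_one_iff.2 (by
      have : (0 : ℝ) < κ₀ / (d + 1) := by positivity
      linarith)
    linarith
  positivity

/-- **B4 LEMMA 2.4 (2.35), FIRST QUANTITY, FOR `G_j(□)Q_j^*` (`A = 0`) — ASSEMBLED FROM THE TWO AUDITED LINEAGES.**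
There are `κ > 0` and `C ≥ 0`, depending only on `d`, `a₋ > 0`, `a₊`, `m²₊`, such that for every fine-lattice scale
`n = L^j ≥ 1`, every box `□ = Π_μ [0, n·M_μ)` of fine sites (`M_μ ≥ 1` unit blocks per direction), every
`a ∈ [a₋, a₊]`, `m² ∈ [0, m²₊]`, and every inverse `GB` of the Neumann box operator `n²(−Δ^N_□) + m² + a·Q^*Q`
(the operator (1.6)/(2.44) of the box in lattice units, kernel `opBoxK (n²) m² (a·n^{−(d+1)}) n`), for every fine box
point `x` and every unit label `y ∈ Π_μ [0, M_μ)`: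
`‖Σ_{x′ ∈ □, blk x′ = y} GB(x, x′)‖ ≤ C · e^{−κ |blk x − y|_∞}` — i.e. `|(G_j(□)Q_j^*)(x,y)| ≤ c₀ e^{−δ₀|x−y|}` with
`x` located by its unit block.  Ingredients: `B4Green244.green244` ((α), via `green244_kernelForm`),
`B4Green244.K_decay` ((β′)), `B4Reflection242.greenBoxQ_decay_src` (images on the source variable) and
`B4Reflection242.boxConst_le_one` (uniformity in the box).  The existence of `GB` is the only hypothesis.
[cite: Balaban1983RegularityDecay, p. 582 Lemma 2.4 (2.35) («|(G_j(□)Q_j^*)(x,y)| ≤ c₀e^{−δ₀|x−y|}»), p. 584 (2.42),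
(2.44), p. 585 (2.48)] -/
theorem greenBoxQ_decay_235 (d : ℕ) (aminus aplus m2plus : ℝ) (ha : 0 < aminus) :
    ∃ κ C : ℝ, 0 < κ ∧ 0 ≤ C ∧ ∀ (n : ℕ), 1 ≤ n → ∀ (a m2 : ℝ), aminus ≤ a → a ≤ aplus → 0 ≤ m2 → m2 ≤ m2plus →
      ∀ (M : Fin (d + 1) → ℕ), (∀ i, 1 ≤ M i) →
      ∀ (GB : Matrix ↥(boxDom (fun i => n * M i)) ↥(boxDom (fun i => n * M i)) ℂ),
        (Matrix.of fun x y : ↥(boxDom (fun i => n * M i)) =>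
            opBoxK ((n : ℂ) ^ 2) (m2 : ℂ) ((a : ℂ) * ((n : ℂ) ^ (d + 1))⁻¹) n (fun i => n * M i) x.1 y.1) * GB = 1 →
        ∀ (x : ↥(boxDom (fun i => n * M i))) (y : Fin (d + 1) → ℤ), y ∈ boxDom M →
          ‖∑ x' : ↥(boxDom (fun i => n * M i)), (if blk n x'.1 = y then GB x x' else 0)‖
            ≤ C * Real.exp (-(κ * supNorm (blk n x.1 - y))) := by
  obtain ⟨κ₀, MK, hκ₀, hMK, hdec⟩ := B4Green244.K_decay d aminus aplus m2plus ha
  refine ⟨κ₀ / (d + 1), C235 d κ₀ MK, by positivity, C235_nonneg d hκ₀ hMK, ?_⟩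
  intro n hn a m2 h1 h2 h3 h4 M hM GB hGB x y hy
  haveI : NeZero n := ⟨by omega⟩
  have ha' : 0 < a := lt_of_lt_of_le ha h1
  have hN : ∀ i, 1 ≤ (fun i => n * M i) i := fun i => Nat.one_le_iff_ne_zero.2 (Nat.mul_ne_zero_iff.2
    ⟨by omega, Nat.one_le_iff_ne_zero.1 (hM i)⟩)
  have hKdec : ∀ u w : Fin (d + 1) → ℤ, ‖B4Green244.K n a m2 u w‖ ≤ MK * Real.exp (-(κ₀ * supNorm (blk n u - w))) :=
    fun u w => hdec n a m2 h1 h2 h3 h4 u w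
  have h := greenBoxQ_decay_src hn hM hN ((n : ℂ) ^ 2) (m2 : ℂ) ((a : ℂ) * ((n : ℂ) ^ (d + 1))⁻¹) hκ₀ hMK
    (fun u w => green244_kernelForm n hn a m2 ha' h3 u w) hKdec GB hGB x hy
  refine h.trans ?_
  have hE : 0 ≤ Real.exp (-(κ₀ / (d + 1) * supNorm (blk n x.1 - y))) := (Real.exp_pos _).le
  unfold C235
  exact mul_le_mul_of_nonneg_right (mul_le_mul_of_nonneg_left (boxConst_le_one hκ₀ hM) hMK) hE

/-! ### §4 Existence of the box propagator: the Neumann box operator with block averaging is invertible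

Folklore finite-dimensional linear algebra, nothing of [B4] is asserted here: for real `c₁ > 0`, `msq ≥ 0`, `a > 0`,
any block side `b` and any box `Π_μ[0, N_μ)` with `N_μ ≥ 1`, the box operator `c₁(−Δ^N_□) + msq + a·𝟙[same block]`
(kernel `opBoxK`) has the Hermitian form `2·Re⟨v, A v⟩ = c₁ Σ_{bonds}|v x − v y|² + 2 msq Σ|v x|² + 2a Σ_β|Σ_{blk = β} v|²`;
a null vector is therefore constant along box bonds, hence constant (the box is connected through its zero corner),
and the block sum over the block of the corner kills the constant.  So `A` is injective, hence a unit, and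
`A · A⁻¹ = 1`: the hypothesis `GB`, `A · GB = 1` of `greenBoxQ_decay_235` is discharged with `GB := A⁻¹`.  (The
tree's `QGQInverse.isUnit_of_coercive` is the real-scalar analogue with a quantified coercivity constant; it is not
used here: the scalars are complex and only definiteness is needed.) -/

section Existence

open ComplexConjugate

/-- the Neumann box operator `c₁(−Δ^N_□) + msq + a·𝟙[blk y = blk x]` (kernel `opBoxK`) as a matrix on the box
`Π_μ[0, N_μ)`. [folklore] -/
def opBox (c₁ msq a : ℂ) (b : ℕ) (N : Fin (d + 1) → ℕ) : Matrix ↥(boxDom N) ↥(boxDom N) ℂ :=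
  Matrix.of fun x y => opBoxK c₁ msq a b N x.1 y.1

/-- the box points adjacent to a box point (the box bonds at `x`). [folklore] -/
def boxNbrs (N : Fin (d + 1) → ℕ) (x : ↥(boxDom N)) : Finset ↥(boxDom N) :=
  Finset.univ.filter fun y => y.1 ∈ nbrs x.1

/-- the box points in the block of a box point. [folklore] -/
def boxBlk (b : ℕ) (N : Fin (d + 1) → ℕ) (x : ↥(boxDom N)) : Finset ↥(boxDom N) :=
  Finset.univ.filter fun y => blk b y.1 = blk b x.1

/-- the in-box degree of a box point, counted on the box side. [folklore] -/
theorem card_boxNbrs (N : Fin (d + 1) → ℕ) (x : ↥(boxDom N)) :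
    (boxNbrs N x).card = ((nbrs x.1).filter fun z => z ∈ boxDom N).card := by
  rw [← Finset.card_subtype]
  unfold boxNbrs
  congr 1
  ext y
  simp [Finset.mem_subtype]

/-- adjacency of box points is symmetric. [folklore] -/
theorem mem_boxNbrs_comm {N : Fin (d + 1) → ℕ} {x y : ↥(boxDom N)} : y ∈ boxNbrs N x ↔ x ∈ boxNbrs N y := by
  unfold boxNbrs
  simp only [Finset.mem_filter, Finset.mem_univ, true_and]
  exact nbrs_comm

/-- a box point is not adjacent to itself. [folklore] -/
theorem not_mem_boxNbrs_self {N : Fin (d + 1) → ℕ} (x : ↥(boxDom N)) : x ∉ boxNbrs N x := by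
  unfold boxNbrs
  simp only [Finset.mem_filter, Finset.mem_univ, true_and]
  exact not_mem_nbrs_self x.1

/-- a box point lies in its own block. [folklore] -/
theorem mem_boxBlk_self (b : ℕ) {N : Fin (d + 1) → ℕ} (x : ↥(boxDom N)) : x ∈ boxBlk b N x := by
  unfold boxBlk
  simp

/-- **THE NEUMANN BOX OPERATOR APPLIED TO A FUNCTION ON THE BOX**:
`(A v)(x) = c₁·Σ_{y ∈ □, y ∼ x}(v x − v y) + msq·v x + a·Σ_{y ∈ □, blk y = blk x} v y`. [folklore] -/
theorem opBox_mulVec (c₁ msq a : ℂ) (b : ℕ) (N : Fin (d + 1) → ℕ) (v : ↥(boxDom N) → ℂ) (x : ↥(boxDom N)) :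
    (opBox c₁ msq a b N).mulVec v x
      = c₁ * ∑ y ∈ boxNbrs N x, (v x - v y) + msq * v x + a * ∑ y ∈ boxBlk b N x, v y := by
  classical
  have hL : ∑ y : ↥(boxDom N), (neumannLapK N x.1 y.1 : ℂ) * v y = ∑ y ∈ boxNbrs N x, (v x - v y) := by
    have hpt : ∀ y : ↥(boxDom N), (neumannLapK N x.1 y.1 : ℂ) * v y
        = (if y = x then ((boxNbrs N x).card : ℂ) * v x else 0) - (if y ∈ boxNbrs N x then v y else 0) := by
      intro y
      by_cases hyx : y = x
      · subst hyx
        simp [neumannLapK, not_mem_boxNbrs_self, card_boxNbrs]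
      · have hyx' : y.1 ≠ x.1 := fun h => hyx (Subtype.ext h)
        by_cases hyn : y.1 ∈ nbrs x.1
        · have hmem : y ∈ boxNbrs N x := by
            unfold boxNbrs; simp only [Finset.mem_filter, Finset.mem_univ, true_and]; exact hyn
          simp [neumannLapK, hyx, hyx', hyn, hmem]
        · have hmem : y ∉ boxNbrs N x := by
            unfold boxNbrs; simp only [Finset.mem_filter, Finset.mem_univ, true_and]; exact hyn
          simp [neumannLapK, hyx, hyx', hyn, hmem]
    simp_rw [hpt]
    rw [Finset.sum_sub_distrib, Finset.sum_ite_eq' Finset.univ x, if_pos (Finset.mem_univ _),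
      ← Finset.sum_filter, Finset.filter_mem_eq_inter, Finset.univ_inter, Finset.sum_sub_distrib,
      Finset.sum_const, nsmul_eq_mul]
  have hD : ∑ y : ↥(boxDom N), diagK msq x.1 y.1 * v y = msq * v x := by
    have hpt : ∀ y : ↥(boxDom N), diagK msq x.1 y.1 * v y = if y = x then msq * v x else 0 := by
      intro y
      by_cases hyx : y = x
      · subst hyx; simp [diagK]
      · have hyx' : y.1 ≠ x.1 := fun h => hyx (Subtype.ext h)
        simp [diagK, hyx, hyx']
    simp_rw [hpt]
    rw [Finset.sum_ite_eq' Finset.univ x, if_pos (Finset.mem_univ _)]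
  have hA : ∑ y : ↥(boxDom N), avgK a b x.1 y.1 * v y = a * ∑ y ∈ boxBlk b N x, v y := by
    unfold boxBlk
    rw [Finset.sum_filter, Finset.mul_sum]
    refine Finset.sum_congr rfl fun y _ => ?_
    simp only [avgK]
    split_ifs <;> simp
  have hmv : (opBox c₁ msq a b N).mulVec v x = ∑ y : ↥(boxDom N), opBoxK c₁ msq a b N x.1 y.1 * v y := rfl
  rw [hmv]
  simp only [opBoxK, add_mul, Finset.sum_add_distrib, mul_assoc, ← Finset.mul_sum]
  rw [hL, hD, hA, add_assoc]

/-- exchanging the two ends of the box bonds in a double sum. [folklore] -/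
theorem sum_boxNbrs_comm {N : Fin (d + 1) → ℕ} (f : ↥(boxDom N) → ↥(boxDom N) → ℂ) :
    ∑ x, ∑ y ∈ boxNbrs N x, f x y = ∑ x, ∑ y ∈ boxNbrs N x, f y x :=
  Finset.sum_comm' fun _ _ =>
    ⟨fun h => ⟨mem_boxNbrs_comm.1 h.2, Finset.mem_univ _⟩, fun h => ⟨Finset.mem_univ _, mem_boxNbrs_comm.1 h.1⟩⟩

/-- **THE BOND FORM**: `2·Σ_x conj(v x)·Σ_{y ∼ x}(v x − v y) = Σ_x Σ_{y ∼ x} |v x − v y|²` (box bonds). [folklore] -/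
theorem two_mul_lapForm {N : Fin (d + 1) → ℕ} (v : ↥(boxDom N) → ℂ) :
    2 * ∑ x, conj (v x) * ∑ y ∈ boxNbrs N x, (v x - v y)
      = ∑ x, ∑ y ∈ boxNbrs N x, (Complex.normSq (v x - v y) : ℂ) := by
  have hswap₁ : ∑ x, ∑ y ∈ boxNbrs N x, conj (v y) * v y = ∑ x, ∑ y ∈ boxNbrs N x, conj (v x) * v x :=
    (sum_boxNbrs_comm fun x y => conj (v x) * v x).symm
  have hswap₂ : ∑ x, ∑ y ∈ boxNbrs N x, conj (v y) * v x = ∑ x, ∑ y ∈ boxNbrs N x, conj (v x) * v y :=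
    (sum_boxNbrs_comm fun x y => conj (v x) * v y).symm
  have hL : ∑ x, conj (v x) * ∑ y ∈ boxNbrs N x, (v x - v y)
      = (∑ x, ∑ y ∈ boxNbrs N x, conj (v x) * v x) - ∑ x, ∑ y ∈ boxNbrs N x, conj (v x) * v y := by
    rw [← Finset.sum_sub_distrib]
    refine Finset.sum_congr rfl fun x _ => ?_
    rw [Finset.mul_sum, ← Finset.sum_sub_distrib]
    refine Finset.sum_congr rfl fun y _ => ?_
    ring
  have hR : ∑ x, ∑ y ∈ boxNbrs N x, (Complex.normSq (v x - v y) : ℂ)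
      = (∑ x, ∑ y ∈ boxNbrs N x, conj (v x) * v x) - (∑ x, ∑ y ∈ boxNbrs N x, conj (v x) * v y)
        - (∑ x, ∑ y ∈ boxNbrs N x, conj (v y) * v x) + ∑ x, ∑ y ∈ boxNbrs N x, conj (v y) * v y := by
    rw [← Finset.sum_sub_distrib, ← Finset.sum_sub_distrib, ← Finset.sum_add_distrib]
    refine Finset.sum_congr rfl fun x _ => ?_
    rw [← Finset.sum_sub_distrib, ← Finset.sum_sub_distrib, ← Finset.sum_add_distrib]
    refine Finset.sum_congr rfl fun y _ => ?_
    rw [Complex.normSq_eq_conj_mul_self, map_sub]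
    ring
  rw [hL, hR, hswap₁, hswap₂]
  ring

/-- **THE BLOCK FORM**: `Σ_x conj(v x)·Σ_{y ∈ □, blk y = blk x} v y = Σ_β |Σ_{blk x = β} v x|²` over the block labels
`β` met by the box. [folklore] -/
theorem avgForm_eq (b : ℕ) {N : Fin (d + 1) → ℕ} (v : ↥(boxDom N) → ℂ) :
    ∑ x, conj (v x) * ∑ y ∈ boxBlk b N x, v y
      = ∑ β ∈ Finset.univ.image (fun x : ↥(boxDom N) => blk b x.1),
          (Complex.normSq (∑ y ∈ Finset.univ.filter (fun y : ↥(boxDom N) => blk b y.1 = β), v y) : ℂ) := by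
  classical
  rw [← Finset.sum_fiberwise_of_maps_to (s := Finset.univ)
    (t := Finset.univ.image fun x : ↥(boxDom N) => blk b x.1) (g := fun x : ↥(boxDom N) => blk b x.1)
    (fun x hx => Finset.mem_image_of_mem _ hx)]
  refine Finset.sum_congr rfl fun β _ => ?_
  rw [Complex.normSq_eq_conj_mul_self, map_sum, Finset.sum_mul]
  refine Finset.sum_congr rfl fun x hx => ?_
  have hx' : blk b x.1 = β := (Finset.mem_filter.1 hx).2
  unfold boxBlk
  rw [hx']

/-- **THE HERMITIAN FORM OF THE NEUMANN BOX OPERATOR** (real coefficients): `2·Σ_x conj(v x)·(A v)(x) =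
c₁·Σ_x Σ_{y ∼ x}|v x − v y|² + 2·msq·Σ_x |v x|² + 2·a·Σ_β |Σ_{blk x = β} v x|²` — a real number. [folklore] -/
theorem quadForm_eq (c₁ msq a : ℝ) (b : ℕ) {N : Fin (d + 1) → ℕ} (v : ↥(boxDom N) → ℂ) :
    2 * ∑ x, conj (v x) * (opBox (c₁ : ℂ) (msq : ℂ) (a : ℂ) b N).mulVec v x
      = ((c₁ * (∑ x, ∑ y ∈ boxNbrs N x, Complex.normSq (v x - v y))
          + 2 * msq * (∑ x, Complex.normSq (v x))
          + 2 * a * (∑ β ∈ Finset.univ.image (fun x : ↥(boxDom N) => blk b x.1),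
              Complex.normSq (∑ y ∈ Finset.univ.filter (fun y : ↥(boxDom N) => blk b y.1 = β), v y)) : ℝ) : ℂ) := by
  have hpt : ∀ x : ↥(boxDom N), conj (v x) * (opBox (c₁ : ℂ) (msq : ℂ) (a : ℂ) b N).mulVec v x
      = (c₁ : ℂ) * (conj (v x) * ∑ y ∈ boxNbrs N x, (v x - v y)) + (msq : ℂ) * (Complex.normSq (v x) : ℂ)
        + (a : ℂ) * (conj (v x) * ∑ y ∈ boxBlk b N x, v y) := by
    intro x
    rw [opBox_mulVec, Complex.normSq_eq_conj_mul_self]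
    ring
  have hsum : ∑ x, conj (v x) * (opBox (c₁ : ℂ) (msq : ℂ) (a : ℂ) b N).mulVec v x
      = (c₁ : ℂ) * (∑ x, conj (v x) * ∑ y ∈ boxNbrs N x, (v x - v y)) + (msq : ℂ) * ∑ x, (Complex.normSq (v x) : ℂ)
        + (a : ℂ) * ∑ x, conj (v x) * ∑ y ∈ boxBlk b N x, v y := by
    simp_rw [hpt]
    rw [Finset.sum_add_distrib, Finset.sum_add_distrib, ← Finset.mul_sum, ← Finset.mul_sum, ← Finset.mul_sum]
  rw [hsum, avgForm_eq b v]
  push_cast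
  linear_combination (c₁ : ℂ) * two_mul_lapForm v

/-- the zero corner of the box. [folklore] -/
theorem zero_mem_boxDom {N : Fin (d + 1) → ℕ} (hN : ∀ i, 1 ≤ N i) : (0 : Fin (d + 1) → ℤ) ∈ boxDom N := by
  rw [mem_boxDom]
  intro i
  simp only [Pi.zero_apply, le_refl, true_and]
  exact_mod_cast hN i

/-- **THE BOX IS CONNECTED**: a function on the box constant along box bonds equals its value at the zero corner
(descend the coordinate sum). [folklore] -/
theorem box_const_of_bonds {N : Fin (d + 1) → ℕ} (hN : ∀ i, 1 ≤ N i) {u : ↥(boxDom N) → ℂ}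
    (h : ∀ x : ↥(boxDom N), ∀ y ∈ boxNbrs N x, u x = u y) (x : ↥(boxDom N)) :
    u x = u ⟨0, zero_mem_boxDom hN⟩ := by
  suffices H : ∀ (k : ℕ) (x : ↥(boxDom N)), (∑ i, x.1 i) ≤ k → u x = u ⟨0, zero_mem_boxDom hN⟩ by
    exact H (∑ i, x.1 i).toNat x (Int.self_le_toNat _)
  intro k
  induction k with
  | zero =>
    intro x hx
    have hx0 : ∀ i, 0 ≤ x.1 i := fun i => ((mem_boxDom).1 x.2 i).1
    have hsum : ∑ i, x.1 i = 0 := le_antisymm (by exact_mod_cast hx) (Finset.sum_nonneg fun i _ => hx0 i)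
    have hxi : ∀ i, x.1 i = 0 := fun i =>
      (Finset.sum_eq_zero_iff_of_nonneg fun i _ => hx0 i).1 hsum i (Finset.mem_univ i)
    have hx' : x = ⟨0, zero_mem_boxDom hN⟩ := Subtype.ext (funext hxi)
    rw [hx']
  | succ k ih =>
    intro x hx
    by_cases hx0 : x.1 = 0
    · have hx' : x = ⟨0, zero_mem_boxDom hN⟩ := Subtype.ext hx0
      rw [hx']
    · obtain ⟨i, hi⟩ : ∃ i, x.1 i ≠ 0 := not_forall.1 fun hall => hx0 (funext hall)
      have hxb := (mem_boxDom).1 x.2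
      have hxi : 1 ≤ x.1 i := by have := (hxb i).1; omega
      have hmem : (x.1 - Pi.single i 1 : Fin (d + 1) → ℤ) ∈ boxDom N := by
        rw [mem_boxDom]
        intro j
        have hj := hxb j
        by_cases hji : j = i
        · subst hji
          simp only [Pi.sub_apply, Pi.single_eq_same]
          constructor <;> omega
        · simp only [Pi.sub_apply, Pi.single_eq_of_ne hji, sub_zero]
          exact hj
      have hadj : (⟨(x.1 - Pi.single i 1 : Fin (d + 1) → ℤ), hmem⟩ : ↥(boxDom N)) ∈ boxNbrs N x := by
        unfold boxNbrs
        simp only [Finset.mem_filter, Finset.mem_univ, true_and]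
        exact mem_nbrs.2 ⟨i, Or.inr rfl⟩
      have hsum : ∑ j, (x.1 - Pi.single i 1 : Fin (d + 1) → ℤ) j ≤ (k : ℤ) := by
        have hs : ∑ j, (x.1 - Pi.single i 1 : Fin (d + 1) → ℤ) j = ∑ j, x.1 j - 1 := by
          simp only [Pi.sub_apply, Finset.sum_sub_distrib, Finset.sum_pi_single', Finset.mem_univ, if_true]
        rw [hs]
        push_cast at hx
        omega
      rw [h x _ hadj]
      exact ih _ hsum

/-- **THE NEUMANN BOX OPERATOR IS INJECTIVE** for `c₁ > 0`, `msq ≥ 0`, `a > 0` (any block side `b`, any box with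
`N_μ ≥ 1`): a null vector has zero bond form and zero block form, so it is constant along box bonds, hence
constant, and the block sum over the block of the zero corner kills the constant. [folklore] -/
theorem opBox_mulVec_injective {c₁ msq a : ℝ} (hc₁ : 0 < c₁) (hmsq : 0 ≤ msq) (ha : 0 < a) (b : ℕ)
    {N : Fin (d + 1) → ℕ} (hN : ∀ i, 1 ≤ N i) :
    Function.Injective (opBox (c₁ : ℂ) (msq : ℂ) (a : ℂ) b N).mulVec := by
  classical
  intro v w hvw
  rw [← sub_eq_zero]
  have h0 : (opBox (c₁ : ℂ) (msq : ℂ) (a : ℂ) b N).mulVec (v - w) = 0 := by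
    rw [Matrix.mulVec_sub, hvw, sub_self]
  -- the Hermitian form of a null vector vanishes
  have hQ := quadForm_eq c₁ msq a b (v - w)
  rw [h0] at hQ
  simp only [Pi.zero_apply, mul_zero, Finset.sum_const_zero] at hQ
  have hR : c₁ * (∑ x, ∑ y ∈ boxNbrs N x, Complex.normSq ((v - w) x - (v - w) y))
      + 2 * msq * (∑ x, Complex.normSq ((v - w) x))
      + 2 * a * (∑ β ∈ Finset.univ.image (fun x : ↥(boxDom N) => blk b x.1),
          Complex.normSq (∑ y ∈ Finset.univ.filter (fun y : ↥(boxDom N) => blk b y.1 = β), (v - w) y)) = 0 := by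
    exact_mod_cast hQ.symm
  have hB₀ : 0 ≤ ∑ x, ∑ y ∈ boxNbrs N x, Complex.normSq ((v - w) x - (v - w) y) :=
    Finset.sum_nonneg fun x _ => Finset.sum_nonneg fun y _ => Complex.normSq_nonneg _
  have hP₀ : 0 ≤ ∑ x, Complex.normSq ((v - w) x) := Finset.sum_nonneg fun x _ => Complex.normSq_nonneg _
  have hS₀ : 0 ≤ ∑ β ∈ Finset.univ.image (fun x : ↥(boxDom N) => blk b x.1),
      Complex.normSq (∑ y ∈ Finset.univ.filter (fun y : ↥(boxDom N) => blk b y.1 = β), (v - w) y) :=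
    Finset.sum_nonneg fun β _ => Complex.normSq_nonneg _
  have hB : ∑ x, ∑ y ∈ boxNbrs N x, Complex.normSq ((v - w) x - (v - w) y) = 0 := by
    nlinarith [mul_nonneg hmsq hP₀, mul_nonneg ha.le hS₀, mul_nonneg hc₁.le hB₀]
  have hS : ∑ β ∈ Finset.univ.image (fun x : ↥(boxDom N) => blk b x.1),
      Complex.normSq (∑ y ∈ Finset.univ.filter (fun y : ↥(boxDom N) => blk b y.1 = β), (v - w) y) = 0 := by
    nlinarith [mul_nonneg hmsq hP₀, mul_nonneg ha.le hS₀, mul_nonneg hc₁.le hB₀]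
  -- zero bond form: constant along box bonds, hence constant
  have hbond : ∀ x : ↥(boxDom N), ∀ y ∈ boxNbrs N x, (v - w) x = (v - w) y := by
    intro x y hy
    have hx := (Finset.sum_eq_zero_iff_of_nonneg fun x _ =>
      Finset.sum_nonneg fun y _ => Complex.normSq_nonneg ((v - w) x - (v - w) y)).1 hB x (Finset.mem_univ x)
    have hxy := (Finset.sum_eq_zero_iff_of_nonneg fun y _ => Complex.normSq_nonneg ((v - w) x - (v - w) y)).1 hx y hy
    exact sub_eq_zero.1 (Complex.normSq_eq_zero.1 hxy)
  have hconst : ∀ x : ↥(boxDom N), (v - w) x = (v - w) ⟨0, zero_mem_boxDom hN⟩ := box_const_of_bonds hN hbond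
  -- zero block form: the block sum over the block of the zero corner vanishes, and it is `card • constant`
  set x₀ : ↥(boxDom N) := ⟨0, zero_mem_boxDom hN⟩ with hx₀
  have hblk : Complex.normSq (∑ y ∈ Finset.univ.filter (fun y : ↥(boxDom N) => blk b y.1 = blk b x₀.1), (v - w) y)
      = 0 :=
    (Finset.sum_eq_zero_iff_of_nonneg fun β _ => Complex.normSq_nonneg _).1 hS (blk b x₀.1)
      (Finset.mem_image_of_mem _ (Finset.mem_univ x₀))
  have hsum0 : ∑ y ∈ Finset.univ.filter (fun y : ↥(boxDom N) => blk b y.1 = blk b x₀.1), (v - w) y = 0 :=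
    Complex.normSq_eq_zero.1 hblk
  rw [Finset.sum_congr rfl fun y _ => hconst y, Finset.sum_const, nsmul_eq_mul] at hsum0
  have hcard : (Finset.univ.filter (fun y : ↥(boxDom N) => blk b y.1 = blk b x₀.1)).card ≠ 0 :=
    Finset.card_ne_zero.2 ⟨x₀, mem_boxBlk_self b x₀⟩
  have hc : (v - w) x₀ = 0 := by
    rcases mul_eq_zero.1 hsum0 with hz | hz
    · exact absurd (by exact_mod_cast hz) hcard
    · exact hz
  funext x
  rw [hconst x]
  exact hc

/-- the Neumann box operator is a unit of the matrix ring (`c₁ > 0`, `msq ≥ 0`, `a > 0`, `N_μ ≥ 1`). [folklore] -/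
theorem opBox_isUnit {c₁ msq a : ℝ} (hc₁ : 0 < c₁) (hmsq : 0 ≤ msq) (ha : 0 < a) (b : ℕ)
    {N : Fin (d + 1) → ℕ} (hN : ∀ i, 1 ≤ N i) : IsUnit (opBox (c₁ : ℂ) (msq : ℂ) (a : ℂ) b N) :=
  Matrix.mulVec_injective_iff_isUnit.1 (opBox_mulVec_injective hc₁ hmsq ha b hN)

/-- **EXISTENCE OF THE NEUMANN BOX PROPAGATOR**: `A · A⁻¹ = 1` for the Neumann box operator `A` with block
averaging (`c₁ > 0`, `msq ≥ 0`, `a > 0`, `N_μ ≥ 1`). [folklore] -/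
theorem opBox_mul_inv {c₁ msq a : ℝ} (hc₁ : 0 < c₁) (hmsq : 0 ≤ msq) (ha : 0 < a) (b : ℕ)
    {N : Fin (d + 1) → ℕ} (hN : ∀ i, 1 ≤ N i) :
    opBox (c₁ : ℂ) (msq : ℂ) (a : ℂ) b N * (opBox (c₁ : ℂ) (msq : ℂ) (a : ℂ) b N)⁻¹ = 1 :=
  Matrix.mul_nonsing_inv _ ((Matrix.isUnit_iff_isUnit_det _).1 (opBox_isUnit hc₁ hmsq ha b hN))

/-- **THE BOX OPERATOR OF (2.44) IN LATTICE UNITS**: on the box `Π_μ[0, n·M_μ)` (`n = L^j` sites per unit block,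
`M_μ` unit blocks in direction `μ`) the operator `n²(−Δ^N_□) + m² + a·Q^*Q` of the dictionary `opK_dictionary`,
i.e. the kernel `opBoxK (n²) (m²) (a·n^{−(d+1)}) n`, as a matrix on the box. [folklore] -/
def boxOp (n : ℕ) (a m2 : ℝ) (M : Fin (d + 1) → ℕ) :
    Matrix ↥(boxDom (fun i => n * M i)) ↥(boxDom (fun i => n * M i)) ℂ :=
  opBox ((n : ℂ) ^ 2) (m2 : ℂ) ((a : ℂ) * ((n : ℂ) ^ (d + 1))⁻¹) n (fun i => n * M i)

/-- the box operator of (2.44) is invertible, `boxOp · boxOp⁻¹ = 1`, for every `n ≥ 1`, `a > 0`, `m² ≥ 0` and every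
box of unit blocks `Π_μ[0, M_μ)` with `M_μ ≥ 1`. [folklore] -/
theorem boxOp_mul_inv {n : ℕ} (hn : 1 ≤ n) {a m2 : ℝ} (ha : 0 < a) (hm : 0 ≤ m2) {M : Fin (d + 1) → ℕ}
    (hM : ∀ i, 1 ≤ M i) : boxOp n a m2 M * (boxOp n a m2 M)⁻¹ = 1 := by
  have hN : ∀ i, 1 ≤ (fun i => n * M i) i := fun i => Nat.one_le_iff_ne_zero.2 (Nat.mul_ne_zero_iff.2
    ⟨by omega, Nat.one_le_iff_ne_zero.1 (hM i)⟩)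
  have hn' : (0 : ℝ) < n := by exact_mod_cast hn
  have hc₁ : (0 : ℝ) < (n : ℝ) ^ 2 := by positivity
  have ha' : (0 : ℝ) < a * ((n : ℝ) ^ (d + 1))⁻¹ := by positivity
  have hEq : boxOp n a m2 M = opBox (((n : ℝ) ^ 2 : ℝ) : ℂ) (m2 : ℂ) ((a * ((n : ℝ) ^ (d + 1))⁻¹ : ℝ) : ℂ) n
      (fun i => n * M i) := by
    simp only [boxOp, Complex.ofReal_pow, Complex.ofReal_natCast, Complex.ofReal_mul, Complex.ofReal_inv]
  rw [hEq]
  exact opBox_mul_inv hc₁ hm ha' n hN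

/-- **[B4] LEMMA 2.4 (2.35), FIRST QUANTITY, WITH THE PROPAGATOR CONSTRUCTED**: there are `κ > 0`, `C ≥ 0`
(depending on `d` and the parameter window only) such that for every `n = L^j ≥ 1`, every `a ∈ [a₋, a₊]` with
`a₋ > 0`, every `m² ∈ [0, m²₊]` and every box of unit blocks `Π_μ[0, M_μ)` (`M_μ ≥ 1`; in lattice units the box is
`Π_μ[0, n·M_μ)`), the box operator `A = boxOp n a m2 M` of (2.44) is invertible, `A·A⁻¹ = 1`, and its inverse
`G_j(□) := A⁻¹` satisfies `‖Σ_{x′ ∈ □, blk x′ = y} G_j(□)(x, x′)‖ ≤ C · e^{−κ |blk x − y|_∞}` for all box points `x` and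
unit blocks `y` of the box — the first estimate of (2.35), `|(G_j(□)Q_j^*)(x,y)| ≤ c₀e^{−δ₀|x−y|}`, with `x` located
by its unit block, now free of hypotheses.  This is `greenBoxQ_decay_235` with its only hypothesis (existence of
`GB`, `A·GB = 1`) discharged by `boxOp_mul_inv`.  The second quantity of (2.35), (2.36) and (2.37) are NOT covered
(see the module docstring, SCOPE).
[cite: Balaban1983RegularityDecay, p. 582 Lemma 2.4 (2.35) («|(G_j(□)Q_j^*)(x,y)| ≤ c₀e^{−δ₀|x−y|}»), p. 584 (2.42),
(2.44), p. 585 (2.48)] -/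
theorem greenBoxQ_decay_235_inv (d : ℕ) (aminus aplus m2plus : ℝ) (ha : 0 < aminus) :
    ∃ κ C : ℝ, 0 < κ ∧ 0 ≤ C ∧ ∀ (n : ℕ), 1 ≤ n → ∀ (a m2 : ℝ), aminus ≤ a → a ≤ aplus → 0 ≤ m2 → m2 ≤ m2plus →
      ∀ (M : Fin (d + 1) → ℕ), (∀ i, 1 ≤ M i) →
        boxOp n a m2 M * (boxOp n a m2 M)⁻¹ = 1 ∧
        ∀ (x : ↥(boxDom (fun i => n * M i))) (y : Fin (d + 1) → ℤ), y ∈ boxDom M →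
          ‖∑ x' : ↥(boxDom (fun i => n * M i)), (if blk n x'.1 = y then (boxOp n a m2 M)⁻¹ x x' else 0)‖
            ≤ C * Real.exp (-(κ * supNorm (blk n x.1 - y))) := by
  obtain ⟨κ, C, hκ, hC, h⟩ := greenBoxQ_decay_235 d aminus aplus m2plus ha
  refine ⟨κ, C, hκ, hC, fun n hn a m2 h1 h2 h3 h4 M hM => ?_⟩
  have hinv : boxOp n a m2 M * (boxOp n a m2 M)⁻¹ = 1 := boxOp_mul_inv hn (lt_of_lt_of_le ha h1) h3 hM
  exact ⟨hinv, fun x y hy => h n hn a m2 h1 h2 h3 h4 M hM _ hinv x y hy⟩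

end Existence

/-! ### §5 The derivative dictionary: `n·(K(z+e_μ,y) − K(z,y))` is the lattice kernel of `GD`, and (2.35), second
quantity, for `G_j(□)Q_j^*`

The printed difference derivative (p. 573) at spacing `ξ = η = L^{−j} = 1/n` acts on the fine variable `x = ξz` of
`(G_jQ_j^*)(x, y)`; on the `l`-th term of (2.48) it produces the factor `∂^ξ_μ(p′+l) = (e^{iξ(p′+l)_μ} − 1)/ξ` of (2.49)
(p. 585), which is b04's `B4StripSumsDeriv.D n (k_μ) (p′_μ)` (`l_μ = 2πk_μ`).  Everything below is finite-sum algebra,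
linearity of the Bochner integral over the zone, and the two lineages' theorems. -/

section Deriv

open Complex MeasureTheory
open Literature.MathematicalPhysics.QuantumFieldTheory.Balaban1983to89.B4Strip
open Literature.MathematicalPhysics.QuantumFieldTheory.Balaban1983to89.B4StripSums
open Literature.MathematicalPhysics.QuantumFieldTheory.Balaban1983to89.B4StripSumsHolder
open scoped Real

/-- linearity of the lattice kernel: differences (zone-integrable multipliers). [folklore] -/
theorem latticeKernel_sub {G₁ G₂ : (Fin d → ℂ) → ℂ} (x : Fin d → ℤ)
    (h₁ : IntegrableOn (integrand G₁ x) (BZ d)) (h₂ : IntegrableOn (integrand G₂ x) (BZ d)) :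
    latticeKernel (fun P => G₁ P - G₂ P) x = latticeKernel G₁ x - latticeKernel G₂ x := by
  unfold latticeKernel fourierBox
  have h : integrand (fun P => G₁ P - G₂ P) x = fun p => integrand G₁ x p - integrand G₂ x p := by
    funext p; unfold integrand; ring
  rw [h, integral_sub h₁ h₂, smul_sub]

/-- linearity of the lattice kernel: constant multiples. [folklore] -/
theorem latticeKernel_const_mul (c : ℂ) (G : (Fin d → ℂ) → ℂ) (x : Fin d → ℤ) :
    latticeKernel (fun P => c * G P) x = c * latticeKernel G x := by
  unfold latticeKernel fourierBox
  have h : integrand (fun P => c * G P) x = fun p => c * integrand G x p := by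
    funext p; unfold integrand; ring
  rw [h, integral_const_mul, mul_smul_comm]

/-- THE DIFFERENTIATED FULL MULTIPLIER: the `l`-sum of (2.48) read at the fine point `z` with the `l`-th term multiplied
by the printed difference-derivative symbol `∂^ξ_μ(p′+l) = (e^{iξ(p′+l)_μ} − 1)/ξ` of (2.49), i.e. by
`D_n(k_μ; p′_μ) = n(e^{i(p′_μ+2πk_μ)/n} − 1)` (`B4StripSumsDeriv.D`):
`GDfull(z; μ; p′) = Σ_k D_n(k_μ;p′_μ) e^{i(p′+2πk)·z/n} V(k;p′) R_k(p′)/E(p′)`.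
[cite: Balaban1983RegularityDecay, (2.48)–(2.49) p. 585 with p. 573 (difference derivative); dictionary] -/
def GDfull (n : ℕ) [NeZero n] (a m2 : ℝ) (z : Fin d → ℤ) (μ : Fin d) (P : Fin d → ℂ) : ℂ :=
  ∑ k : Fin d → Fin n, B4StripSumsDeriv.D n (k μ : ℕ) (P μ) *
    (PhZ n k z P * B4Green244.V n k P * R n m2 k P / E n a m2 P)

/-- the forward fine-lattice step of the full multiplier is `ξ = 1/n` times the differentiated multiplier:
`Gfull(z + e_μ; p′) − Gfull(z; p′) = n⁻¹ · GDfull(z; μ; p′)` — term by term `e^{i(p′+l)_μ ξ} − 1 = ξ·∂^ξ_μ(p′+l)`.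
[cite: Balaban1983RegularityDecay, (2.48)–(2.49) p. 585; dictionary] -/
theorem Gfull_add_e_sub (n : ℕ) [NeZero n] (a m2 : ℝ) (z : Fin d → ℤ) (μ : Fin d) (P : Fin d → ℂ) :
    B4Green244.Gfull n a m2 (z + B4Green244.e μ) P - B4Green244.Gfull n a m2 z P
      = ((n : ℂ))⁻¹ * GDfull n a m2 z μ P := by
  unfold B4Green244.Gfull GDfull
  rw [Finset.mul_sum, ← Finset.sum_sub_distrib]
  refine Finset.sum_congr rfl fun k _ => ?_
  rw [B4Green244.PhZ_add_e]
  unfold B4StripSumsDeriv.D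
  have hn : (n : ℂ) ≠ 0 := Nat.cast_ne_zero.mpr (NeZero.ne n)
  rw [show I * (P μ + 2 * π * ((k μ : ℕ) : ℂ)) / n = I * ((P μ + 2 * π * ((k μ : ℕ) : ℂ)) / n) by
    rw [mul_div_assoc]]
  field_simp

/-- at `z = n x⁰ + τ` the differentiated full multiplier is the block phase times b04's derivative multiplier:
`GDfull(n x⁰ + τ; μ; p′) = e^{ip′·x⁰} GD_{n,a,m²,τ,μ}(p′)` (`B4StripSumsDeriv.GD`). [cite: Balaban1983RegularityDecay,
(2.48)–(2.49) p. 585; dictionary] -/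
theorem GDfull_finePt (n : ℕ) [NeZero n] (a m2 : ℝ) (x : Fin d → ℤ) (j : Fin d → Fin n) (μ : Fin d)
    (P : Fin d → ℂ) :
    GDfull n a m2 (B4Green244.finePt n x j) μ P = cexp (I * B4Green244.phaseC P x) * B4StripSumsDeriv.GD n a m2 j μ P := by
  unfold GDfull B4StripSumsDeriv.GD B4StripSumsDeriv.termD term F B4Green244.V
  rw [Finset.mul_sum]
  refine Finset.sum_congr rfl fun k _ => ?_
  rw [B4Green244.PhZ_finePt n (NeZero.ne n), mul_assoc (cexp _), ← Finset.prod_mul_distrib]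
  ring

/-- **THE IDENTIFICATION (position space).**  For `n ≥ 1`, `a > 0`, `m² ≥ 0`, every fine point `z`, unit label `y`
and direction `μ`: `K(z + e_μ, y) − K(z, y) = n⁻¹ · latticeKernel GD_{n,a,m²,z mod n,μ} (⌊z/n⌋ − y)`, i.e.
`(∂^ξ_μ G_jQ_j^*)(ξz, y) = n[K(z+e_μ,y) − K(z,y)] = (2π)^{-d}∫ GD(p′)e^{ip′·(x⁰−y)}dp′` — the sentence of
`B4StripSumsDeriv.GD`'s docstring, now a theorem. [cite: Balaban1983RegularityDecay, p. 573 («(∂^η_μ A)(x) =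
η^{−1}(A(x+ηe_μ) − A(x))»), (2.48)–(2.49) p. 585; dictionary] -/
theorem K_add_e_sub (n : ℕ) [NeZero n] (hn : 1 ≤ n) (a m2 : ℝ) (ha : 0 < a) (hm : 0 ≤ m2)
    (z y : Fin d → ℤ) (μ : Fin d) :
    B4Green244.K n a m2 (z + B4Green244.e μ) y - B4Green244.K n a m2 z y
      = ((n : ℂ))⁻¹ * latticeKernel (B4StripSumsDeriv.GD n a m2 (B4Green244.offset n z) μ)
          (B4Green244.coarse n z - y) := by
  have hint : ∀ w : Fin d → ℤ, IntegrableOn (integrand (B4Green244.Gfull n a m2 w) (-y)) (BZ d) := fun w =>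
    B4Green244.integrableOn_of_differentiableAt
      (fun p hp => B4Green244.differentiableAt_Gfull n hn a m2 ha hm w p hp) (-y)
  rw [B4Green244.K_eq, B4Green244.K_eq, ← latticeKernel_sub (-y) (hint _) (hint _)]
  have h1 : (fun P => B4Green244.Gfull n a m2 (z + B4Green244.e μ) P - B4Green244.Gfull n a m2 z P)
      = fun P => ((n : ℂ))⁻¹ * GDfull n a m2 z μ P := funext fun P => Gfull_add_e_sub n a m2 z μ P
  have h2 : GDfull n a m2 z μ
      = fun P => cexp (I * B4Green244.phaseC P (B4Green244.coarse n z)) *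
          B4StripSumsDeriv.GD n a m2 (B4Green244.offset n z) μ P := by
    funext P
    rw [← GDfull_finePt, B4Green244.finePt_coarse_offset]
  rw [h1, latticeKernel_const_mul, h2, B4Green244.latticeKernel_phase_mul, neg_add_eq_sub]

/-- one fine step moves the block label by at most one: `|⌊(z+e_μ)/n⌋ − ⌊z/n⌋|_∞ ≤ 1`. [folklore] -/
theorem supNorm_coarse_add_e_sub_le (n : ℕ) (hn : 1 ≤ n) (z : Fin (d + 1) → ℤ) (μ : Fin (d + 1)) :
    supNorm (B4Green244.coarse n (z + B4Green244.e μ) - B4Green244.coarse n z) ≤ 1 := by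
  apply supNorm_le_of_forall
  intro i
  have hn' : (0 : ℤ) < n := by exact_mod_cast hn
  simp only [B4Green244.coarse, B4Green244.e, Pi.sub_apply, Pi.add_apply]
  by_cases hi : i = μ
  · subst hi
    rw [Pi.single_eq_same]
    have h1 : z i / n ≤ (z i + 1) / n := Int.ediv_le_ediv hn' (by omega)
    have h2 : (z i + 1) / n < z i / n + 2 := by
      rw [Int.ediv_lt_iff_lt_mul hn']
      have := Int.lt_ediv_add_one_mul_self (z i) hn'
      nlinarith
    have h3 : |(z i + 1) / n - z i / n| ≤ 1 := by
      rw [abs_le]; omega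
    exact_mod_cast h3
  · rw [Pi.single_eq_of_ne hi, add_zero, sub_self, abs_zero]
    norm_num


/-- **(2.35), SECOND QUANTITY, AT THE KERNEL LEVEL — BOTH ONE-SIDED FINE STEPS.**  There are `κ > 0`, `M ≥ 0`, depending
only on `d`, `a₋ > 0`, `a₊`, `m²₊`, such that for every scale `n = L^j ≥ 1`, `a ∈ [a₋, a₊]`, `m² ∈ [0, m²₊]`, direction
`μ`, fine point `z` and unit label `y`:
`‖n·(K(z + e_μ, y) − K(z, y))‖ ≤ M e^{−κ|⌊z/n⌋ − y|_∞}` and `‖n·(K(z − e_μ, y) − K(z, y))‖ ≤ M e^{−κ|⌊z/n⌋ − y|_∞}`,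
i.e. `|(∂^ξ_μ G_jQ_j^*)(x, y)| ≤ c₀e^{−δ₀|x−y|}` for the forward and the backward difference derivative, `x` located by its
unit block — `B4StripSumsDeriv.dkernel248_decay` read through `K_add_e_sub` (backward step: base point `z − e_μ`, whose
block label is within sup-distance `1` of that of `z`, absorbed into `M` as a factor `e^{κ}`).
[cite: Balaban1983RegularityDecay, Lemma 2.4 (2.35) p. 582 (second quantity), p. 573, (2.48)–(2.49) p. 585] -/
theorem K_deriv_decay (d : ℕ) (aminus aplus m2plus : ℝ) (ha : 0 < aminus) :
    ∃ κ M : ℝ, 0 < κ ∧ 0 ≤ M ∧ ∀ (n : ℕ) [NeZero n] (a m2 : ℝ), aminus ≤ a → a ≤ aplus → 0 ≤ m2 →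
      m2 ≤ m2plus → ∀ (μ : Fin (d + 1)) (z y : Fin (d + 1) → ℤ),
        ‖(n : ℂ) * (B4Green244.K n a m2 (z + Pi.single μ 1) y - B4Green244.K n a m2 z y)‖
            ≤ M * Real.exp (-(κ * supNorm (B4Green244.coarse n z - y))) ∧
        ‖(n : ℂ) * (B4Green244.K n a m2 (z + Pi.single μ (-1)) y - B4Green244.K n a m2 z y)‖
            ≤ M * Real.exp (-(κ * supNorm (B4Green244.coarse n z - y))) := by
  obtain ⟨κ, M, hκ, hM, h⟩ := B4StripSumsDeriv.dkernel248_decay d aminus aplus m2plus ha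
  refine ⟨κ, M * Real.exp κ, hκ, by positivity, ?_⟩
  intro n _ a m2 h1 h2 h3 h4 μ z y
  have hn : 1 ≤ n := Nat.one_le_iff_ne_zero.2 (NeZero.ne n)
  have ha' : 0 < a := lt_of_lt_of_le ha h1
  have hnC : (n : ℂ) ≠ 0 := Nat.cast_ne_zero.2 (NeZero.ne n)
  have fwd : ∀ w : Fin (d + 1) → ℤ,
      ‖(n : ℂ) * (B4Green244.K n a m2 (w + B4Green244.e μ) y - B4Green244.K n a m2 w y)‖
        ≤ M * Real.exp (-(κ * supNorm (B4Green244.coarse n w - y))) := by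
    intro w
    rw [K_add_e_sub n hn a m2 ha' h3 w y μ, ← mul_assoc, mul_inv_cancel₀ hnC, one_mul]
    exact h n a m2 h1 h2 h3 h4 _ μ _
  have hM1 : M ≤ M * Real.exp κ := le_mul_of_one_le_right hM (Real.one_le_exp hκ.le)
  constructor
  · exact (fwd z).trans (mul_le_mul_of_nonneg_right hM1 (Real.exp_pos _).le)
  · obtain ⟨w, rfl⟩ : ∃ w, z = w + B4Green244.e μ := ⟨z - B4Green244.e μ, (sub_add_cancel _ _).symm⟩
    have hw : w + B4Green244.e μ + Pi.single μ (-1) = w := by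
      rw [add_assoc, B4Green244.e, ← Pi.single_add, add_neg_cancel, Pi.single_zero, add_zero]
    rw [hw, ← norm_neg]
    have e1 : -((n : ℂ) * (B4Green244.K n a m2 w y - B4Green244.K n a m2 (w + B4Green244.e μ) y))
        = (n : ℂ) * (B4Green244.K n a m2 (w + B4Green244.e μ) y - B4Green244.K n a m2 w y) := by ring
    rw [e1]
    refine (fwd w).trans ?_
    have hs : supNorm (B4Green244.coarse n (w + B4Green244.e μ) - y) ≤ supNorm (B4Green244.coarse n w - y) + 1 := by
      have h' := supNorm_add_le (B4Green244.coarse n w - y)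
        (B4Green244.coarse n (w + B4Green244.e μ) - B4Green244.coarse n w)
      rw [show B4Green244.coarse n w - y + (B4Green244.coarse n (w + B4Green244.e μ) - B4Green244.coarse n w)
          = B4Green244.coarse n (w + B4Green244.e μ) - y by abel] at h'
      linarith [supNorm_coarse_add_e_sub_le n hn w μ]
    rw [mul_assoc, ← Real.exp_add]
    refine mul_le_mul_of_nonneg_left (Real.exp_le_exp.2 ?_) hM
    have := mul_le_mul_of_nonneg_left hs hκ.le
    linarith

/-- **B4 LEMMA 2.4 (2.35), SECOND QUANTITY, FOR `G_j(□)Q_j^*` (`A = 0`) — ASSEMBLED FROM THE TWO AUDITED LINEAGES.**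
There are `κ > 0` and `C ≥ 0`, depending only on `d`, `a₋ > 0`, `a₊`, `m²₊`, such that for every fine-lattice scale
`n = L^j ≥ 1`, every box `□ = Π_ν [0, n·M_ν)` of fine sites (`M_ν ≥ 1` unit blocks per direction), every `a ∈ [a₋, a₊]`,
`m² ∈ [0, m²₊]`, every inverse `GB` of the Neumann box operator of (2.44) (kernel `opBoxK (n²) m² (a·n^{−(d+1)}) n`), every
direction `μ`, every pair of fine box points `x`, `x + e_μ` (both in `□`) and every unit label `y ∈ Π_ν [0, M_ν)`:
`‖n · Σ_{x′ ∈ □, blk x′ = y} (GB(x + e_μ, x′) − GB(x, x′))‖ ≤ C · e^{−κ |blk x − y|_∞}` — i.e.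
`|(∂_μ^{L^{−j}} G_j(□)Q_j^*)(x, y)| ≤ c₀ e^{−δ₀|x−y|}` («(∂^η_μ A)(x) = η^{−1}(A(x+ηe_μ) − A(x))», `η = L^{−j} = 1/n`), `x`
located by its unit block.  Ingredients: `B4Green244.green244` (via `green244_kernelForm`), `B4Green244.K_decay`,
`K_deriv_decay` (from `B4StripSumsDeriv.dkernel248_decay` via `K_add_e_sub`), `B4Reflection242.greenBoxQ_deriv_decay_src`
(images on the source variable, one-sided steps (γ)) and `B4Reflection242.boxConst_le_one`; the common rate is the
minimum of the two kernel rates.  The existence of `GB` is the only hypothesis (discharged in `greenBoxQ_deriv_decay_235_inv`).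
[cite: Balaban1983RegularityDecay, p. 582 Lemma 2.4 (2.35) («|(∂_μ^{L^{−j}} G_j(□)Q_j^*)(x,y)| ≤ c₀e^{−δ₀|x−y|}»), p. 573,
p. 584 (2.42), (2.44), p. 585 (2.48)–(2.49)] -/
theorem greenBoxQ_deriv_decay_235 (d : ℕ) (aminus aplus m2plus : ℝ) (ha : 0 < aminus) :
    ∃ κ C : ℝ, 0 < κ ∧ 0 ≤ C ∧ ∀ (n : ℕ), 1 ≤ n → ∀ (a m2 : ℝ), aminus ≤ a → a ≤ aplus → 0 ≤ m2 → m2 ≤ m2plus →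
      ∀ (M : Fin (d + 1) → ℕ), (∀ i, 1 ≤ M i) →
      ∀ (GB : Matrix ↥(boxDom (fun i => n * M i)) ↥(boxDom (fun i => n * M i)) ℂ),
        (Matrix.of fun x y : ↥(boxDom (fun i => n * M i)) =>
            opBoxK ((n : ℂ) ^ 2) (m2 : ℂ) ((a : ℂ) * ((n : ℂ) ^ (d + 1))⁻¹) n (fun i => n * M i) x.1 y.1) * GB = 1 →
        ∀ (μ : Fin (d + 1)) (x xe : ↥(boxDom (fun i => n * M i))), xe.1 = x.1 + Pi.single μ 1 →
        ∀ (y : Fin (d + 1) → ℤ), y ∈ boxDom M →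
          ‖(n : ℂ) * ∑ x' : ↥(boxDom (fun i => n * M i)), (if blk n x'.1 = y then GB xe x' - GB x x' else 0)‖
            ≤ C * Real.exp (-(κ * supNorm (blk n x.1 - y))) := by
  obtain ⟨κ₁, MK, hκ₁, hMK, hdec⟩ := B4Green244.K_decay d aminus aplus m2plus ha
  obtain ⟨κ₂, MD, hκ₂, hMD, hder⟩ := K_deriv_decay d aminus aplus m2plus ha
  obtain ⟨κ₀, hκ₀1, hκ₀2, hκ₀⟩ : ∃ κ₀, κ₀ ≤ κ₁ ∧ κ₀ ≤ κ₂ ∧ 0 < κ₀ :=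
    ⟨min κ₁ κ₂, min_le_left _ _, min_le_right _ _, lt_min hκ₁ hκ₂⟩
  refine ⟨κ₀ / (d + 1), C235 d κ₀ MD, by positivity, C235_nonneg d hκ₀ hMD, ?_⟩
  intro n hn a m2 h1 h2 h3 h4 M hM GB hGB μ x xe hxe y hy
  haveI : NeZero n := ⟨by omega⟩
  have ha' : 0 < a := lt_of_lt_of_le ha h1
  have hN : ∀ i, 1 ≤ (fun i => n * M i) i := fun i => Nat.one_le_iff_ne_zero.2 (Nat.mul_ne_zero_iff.2
    ⟨by omega, Nat.one_le_iff_ne_zero.1 (hM i)⟩)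
  have hn0 : (0 : ℝ) < n := by exact_mod_cast hn
  have hn0' : (n : ℝ) ≠ 0 := hn0.ne'
  have hweak : ∀ {κ : ℝ}, κ₀ ≤ κ → ∀ s : ℝ, 0 ≤ s → Real.exp (-(κ * s)) ≤ Real.exp (-(κ₀ * s)) :=
    fun hk s hs => Real.exp_le_exp.2 (neg_le_neg (mul_le_mul_of_nonneg_right hk hs))
  have hKdec : ∀ u w : Fin (d + 1) → ℤ, ‖B4Green244.K n a m2 u w‖ ≤ MK * Real.exp (-(κ₀ * supNorm (blk n u - w))) :=
    fun u w => (hdec n a m2 h1 h2 h3 h4 u w).trans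
      (mul_le_mul_of_nonneg_left (hweak hκ₀1 _ (supNorm_nonneg _)) hMK)
  have hKder : ∀ u w : Fin (d + 1) → ℤ,
      ‖B4Green244.K n a m2 (u + Pi.single μ 1) w - B4Green244.K n a m2 u w‖
          ≤ MD / n * Real.exp (-(κ₀ * supNorm (blk n u - w))) ∧
      ‖B4Green244.K n a m2 (u + Pi.single μ (-1)) w - B4Green244.K n a m2 u w‖
          ≤ MD / n * Real.exp (-(κ₀ * supNorm (blk n u - w))) := by
    intro u w
    obtain ⟨hf, hb⟩ := hder n a m2 h1 h2 h3 h4 μ u w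
    have conv : ∀ {D : ℂ}, ‖(n : ℂ) * D‖ ≤ MD * Real.exp (-(κ₂ * supNorm (blk n u - w))) →
        ‖D‖ ≤ MD / n * Real.exp (-(κ₀ * supNorm (blk n u - w))) := by
      intro D hD
      rw [norm_mul, Complex.norm_natCast] at hD
      have hD' : (n : ℝ) * ‖D‖ ≤ MD * Real.exp (-(κ₀ * supNorm (blk n u - w))) :=
        hD.trans (mul_le_mul_of_nonneg_left (hweak hκ₀2 _ (supNorm_nonneg _)) hMD)
      rw [div_mul_eq_mul_div, le_div_iff₀ hn0]
      linarith
    exact ⟨conv hf, conv hb⟩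
  have h := greenBoxQ_deriv_decay_src hn hM hN ((n : ℂ) ^ 2) (m2 : ℂ) ((a : ℂ) * ((n : ℂ) ^ (d + 1))⁻¹) hκ₀ hMK
    (by positivity : (0 : ℝ) ≤ MD / n) (fun u w => green244_kernelForm n hn a m2 ha' h3 u w) hKdec μ hKder GB hGB
    x xe hxe hy
  have lift : ∀ {S : ℂ} {B E : ℝ}, ‖S‖ ≤ MD / n * B * E → ‖(n : ℂ) * S‖ ≤ MD * B * E := by
    intro S B E hS
    rw [norm_mul, Complex.norm_natCast]
    have h' := mul_le_mul_of_nonneg_left hS hn0.le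
    rwa [show (n : ℝ) * (MD / n * B * E) = MD * B * E by field_simp] at h'
  refine (lift h).trans ?_
  unfold C235
  exact mul_le_mul_of_nonneg_right (mul_le_mul_of_nonneg_left (boxConst_le_one hκ₀ hM) hMD) (Real.exp_pos _).le

/-- **(2.35), SECOND QUANTITY, FOR `G_j(□)Q_j^*`, HYPOTHESIS-FREE**: the same bound for the constructed box propagator
`GB := (boxOp n a m2 M)⁻¹` (§4: `boxOp · boxOp⁻¹ = 1` for `n ≥ 1`, `a > 0`, `m² ≥ 0`, `M_ν ≥ 1`).
[cite: Balaban1983RegularityDecay, p. 582 Lemma 2.4 (2.35) (second quantity), p. 573, p. 584 (2.44), p. 585 (2.48)–(2.49)] -/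
theorem greenBoxQ_deriv_decay_235_inv (d : ℕ) (aminus aplus m2plus : ℝ) (ha : 0 < aminus) :
    ∃ κ C : ℝ, 0 < κ ∧ 0 ≤ C ∧ ∀ (n : ℕ), 1 ≤ n → ∀ (a m2 : ℝ), aminus ≤ a → a ≤ aplus → 0 ≤ m2 → m2 ≤ m2plus →
      ∀ (M : Fin (d + 1) → ℕ), (∀ i, 1 ≤ M i) →
        boxOp n a m2 M * (boxOp n a m2 M)⁻¹ = 1 ∧
        ∀ (μ : Fin (d + 1)) (x xe : ↥(boxDom (fun i => n * M i))), xe.1 = x.1 + Pi.single μ 1 →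
        ∀ (y : Fin (d + 1) → ℤ), y ∈ boxDom M →
          ‖(n : ℂ) * ∑ x' : ↥(boxDom (fun i => n * M i)),
              (if blk n x'.1 = y then (boxOp n a m2 M)⁻¹ xe x' - (boxOp n a m2 M)⁻¹ x x' else 0)‖
            ≤ C * Real.exp (-(κ * supNorm (blk n x.1 - y))) := by
  obtain ⟨κ, C, hκ, hC, h⟩ := greenBoxQ_deriv_decay_235 d aminus aplus m2plus ha
  refine ⟨κ, C, hκ, hC, fun n hn a m2 h1 h2 h3 h4 M hM => ?_⟩
  have hinv : boxOp n a m2 M * (boxOp n a m2 M)⁻¹ = 1 := boxOp_mul_inv hn (lt_of_lt_of_le ha h1) h3 hM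
  exact ⟨hinv, fun μ x xe hxe y hy => h n hn a m2 h1 h2 h3 h4 M hM _ hinv μ x xe hxe y hy⟩

end Deriv

/-! ### §6 The Hölder dictionary: `(n/|σ|_∞)^α·n·[(K(z+σ+e_μ,y) − K(z+σ,y)) − (K(z+e_μ,y) − K(z,y))]` is the lattice
kernel of `GH`, and (2.36) for `G_j(□)Q_j^*`

The printed Hölder quotient (2.36) (p. 582) compares the difference derivative `∂^ξ_μ` of `(G_j(□)Q_j^*)(·, y)` at two
fine points `x`, `x′ = x + ξσ`; on the `l`-th term of (2.48) the difference produces the factor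
`e^{i(p′+l)·(x−x′)} − 1` of (2.49) (p. 585; printed at the base point `x′`, «we have assumed that |x′−y| ≤ |x−y|»),
which is b04's `PhZ n k σ p′ − 1` up to the exchange of `x`, `x′` (a sign), and the weight `1/|x−x′|^α` is
`(n/|σ|_∞)^α` in the sup norm of the fine lattice (b04's `B4StripSumsHolder.GH`).  p. 586: «Shifting the domain of
integration in (2.49) into a complex domain in the direction of the vector x′ − y, we can bound the left hand side
of (2.49) by a constant depending on α multiplied by the exponential factor e^{−δ₀|x′−y|} = e^{−δ₀dist({x,x′},y)}. We
get the inequality (2.36).» — that shift is b04's `hkernel248_decay`; everything below is finite-sum algebra,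
linearity of the Bochner integral over the zone, the §9 images pattern of `B4Reflection242` for a second difference,
and the two lineages' theorems. -/

section Holder

open Complex MeasureTheory
open Literature.MathematicalPhysics.QuantumFieldTheory.Balaban1983to89.B4Strip
open Literature.MathematicalPhysics.QuantumFieldTheory.Balaban1983to89.B4StripSums
open Literature.MathematicalPhysics.QuantumFieldTheory.Balaban1983to89.B4StripSumsHolder
open scoped Real

/-- the full phase is multiplicative in the fine point: `e^{i(p′+l)·(z+σ)/n} = e^{i(p′+l)·z/n} e^{i(p′+l)·σ/n}`. [folklore] -/
theorem PhZ_add (n : ℕ) (k : Fin d → Fin n) (z σ : Fin d → ℤ) (P : Fin d → ℂ) :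
    PhZ n k (z + σ) P = PhZ n k z P * PhZ n k σ P := by
  unfold PhZ
  rw [← Finset.prod_mul_distrib]
  refine Finset.prod_congr rfl fun ν _ => ?_
  unfold efZ
  rw [← Complex.exp_add, Pi.add_apply]
  congr 1
  push_cast
  ring

/-- THE HÖLDER-DIFFERENCE FULL MULTIPLIER: the `l`-sum of (2.49) read at the fine base point `z` and the fine
displacement `σ` (`x′ − x = ξσ`), `l`-th term `(e^{i(p′+l)·ξσ} − 1) ∂^ξ_μ(p′+l) e^{i(p′+l)·ξz} u_j(p′+l) R_k(p′)/E(p′)`: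
`GHfull(z; μ; σ; p′) = Σ_k (PhZ_k(σ) − 1) D_n(k_μ;p′_μ) e^{i(p′+2πk)·z/n} V(k;p′) R_k(p′)/E(p′)` — the difference
`GDfull(z + σ) − GDfull(z)` of the differentiated multipliers (`GDfull_add_sub`), WITHOUT the Hölder weight
`|x−x′|^{−α}`. [cite: Balaban1983RegularityDecay, (2.49) p. 585 with p. 573 (difference derivative); dictionary] -/
def GHfull (n : ℕ) [NeZero n] (a m2 : ℝ) (z : Fin d → ℤ) (μ : Fin d) (σ : Fin d → ℤ) (P : Fin d → ℂ) : ℂ :=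
  ∑ k : Fin d → Fin n, (PhZ n k σ P - 1) * (B4StripSumsDeriv.D n (k μ : ℕ) (P μ) *
    (PhZ n k z P * B4Green244.V n k P * R n m2 k P / E n a m2 P))

/-- `GDfull(z + σ; μ) − GDfull(z; μ) = GHfull(z; μ; σ)`: term by term `e^{i(p′+l)·ξ(z+σ)} − e^{i(p′+l)·ξz}
= (e^{i(p′+l)·ξσ} − 1)e^{i(p′+l)·ξz}` (the printed factor `e^{i(p′+l)·(x−x′)} − 1` of (2.49)).
[cite: Balaban1983RegularityDecay, (2.49) p. 585; dictionary] -/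
theorem GDfull_add_sub (n : ℕ) [NeZero n] (a m2 : ℝ) (z σ : Fin d → ℤ) (μ : Fin d) (P : Fin d → ℂ) :
    GDfull n a m2 (z + σ) μ P - GDfull n a m2 z μ P = GHfull n a m2 z μ σ P := by
  unfold GDfull GHfull
  rw [← Finset.sum_sub_distrib]
  refine Finset.sum_congr rfl fun k _ => ?_
  rw [PhZ_add]
  ring

/-- at `z = n x⁰ + τ` the Hölder-difference full multiplier is the block phase times b04's `l`-sum of (2.49):
`GHfull(n x⁰ + τ; μ; σ; p′) = e^{ip′·x⁰} Σ_k termH_{n,a,m²,τ,μ,σ}(k; p′)` (`B4StripSumsHolder.termH`).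
[cite: Balaban1983RegularityDecay, (2.49) p. 585; dictionary] -/
theorem GHfull_finePt (n : ℕ) [NeZero n] (a m2 : ℝ) (x : Fin d → ℤ) (j : Fin d → Fin n) (μ : Fin d)
    (σ : Fin d → ℤ) (P : Fin d → ℂ) :
    GHfull n a m2 (B4Green244.finePt n x j) μ σ P
      = cexp (I * B4Green244.phaseC P x) * ∑ k : Fin d → Fin n, termH n a m2 j μ σ k P := by
  unfold GHfull termH B4StripSumsDeriv.termD term F B4Green244.V
  rw [Finset.mul_sum]
  refine Finset.sum_congr rfl fun k _ => ?_
  rw [B4Green244.PhZ_finePt n (NeZero.ne n), mul_assoc (cexp _), ← Finset.prod_mul_distrib]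
  ring

/-- with the Hölder weight: `(n/|σ|_∞)^α · GHfull(n x⁰ + τ; μ; σ; p′) = e^{ip′·x⁰} · GH_{α,n,a,m²,τ,μ,σ}(p′)` — b04's
multiplier `B4StripSumsHolder.GH` of the Hölder quotient (dimension `d + 1`). [cite: Balaban1983RegularityDecay,
(2.36) p. 582 with (2.49) p. 585; dictionary] -/
theorem GH_scaled_finePt (α : ℝ) (n : ℕ) [NeZero n] (a m2 : ℝ) (x : Fin (d + 1) → ℤ) (j : Fin (d + 1) → Fin n)
    (μ : Fin (d + 1)) (σ : Fin (d + 1) → ℤ) (P : Fin (d + 1) → ℂ) :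
    ((((n : ℝ) / supNorm σ) ^ α : ℝ) : ℂ) * GHfull n a m2 (B4Green244.finePt n x j) μ σ P
      = cexp (I * B4Green244.phaseC P x) * GH α n a m2 j μ σ P := by
  rw [GHfull_finePt]
  unfold GH
  ring

/-- the differentiated full multiplier is `n` times the forward step of the full multiplier:
`GDfull(w; μ) = n·(Gfull(w + e_μ) − Gfull(w))`. [cite: Balaban1983RegularityDecay, (2.48)–(2.49) p. 585; dictionary] -/
theorem GDfull_eq_mul_sub (n : ℕ) [NeZero n] (a m2 : ℝ) (w : Fin d → ℤ) (μ : Fin d) (P : Fin d → ℂ) :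
    GDfull n a m2 w μ P
      = (n : ℂ) * (B4Green244.Gfull n a m2 (w + B4Green244.e μ) P - B4Green244.Gfull n a m2 w P) := by
  rw [Gfull_add_e_sub, ← mul_assoc, mul_inv_cancel₀ (Nat.cast_ne_zero.2 (NeZero.ne n)), one_mul]

/-- the differentiated full multiplier is holomorphic at every point of the real zone (`n ≥ 1`, `a > 0`, `m² ≥ 0`).
[folklore] -/
theorem differentiableAt_GDfull (n : ℕ) [NeZero n] (hn : 1 ≤ n) (a m2 : ℝ) (ha : 0 < a) (hm : 0 ≤ m2)
    (w : Fin d → ℤ) (μ : Fin d) (p : Fin d → ℝ) (hp : p ∈ BZ d) :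
    DifferentiableAt ℂ (GDfull n a m2 w μ) (ofRealVec p) := by
  have h : GDfull n a m2 w μ
      = fun P => (n : ℂ) * (B4Green244.Gfull n a m2 (w + B4Green244.e μ) P - B4Green244.Gfull n a m2 w P) :=
    funext fun P => GDfull_eq_mul_sub n a m2 w μ P
  rw [h]
  exact ((B4Green244.differentiableAt_Gfull n hn a m2 ha hm _ p hp).sub
    (B4Green244.differentiableAt_Gfull n hn a m2 ha hm _ p hp)).const_mul _

/-- the forward fine step of `K` as the lattice kernel of the differentiated FULL multiplier:
`K(w + e_μ, y) − K(w, y) = n⁻¹ · latticeKernel GDfull(w; μ) (−y)` (the first half of `K_add_e_sub`, before passing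
to the block offset). [cite: Balaban1983RegularityDecay, p. 573, (2.48)–(2.49) p. 585; dictionary] -/
theorem K_add_e_sub_GDfull (n : ℕ) [NeZero n] (hn : 1 ≤ n) (a m2 : ℝ) (ha : 0 < a) (hm : 0 ≤ m2)
    (w y : Fin d → ℤ) (μ : Fin d) :
    B4Green244.K n a m2 (w + B4Green244.e μ) y - B4Green244.K n a m2 w y
      = ((n : ℂ))⁻¹ * latticeKernel (GDfull n a m2 w μ) (-y) := by
  have hint : ∀ w : Fin d → ℤ, IntegrableOn (integrand (B4Green244.Gfull n a m2 w) (-y)) (BZ d) := fun w =>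
    B4Green244.integrableOn_of_differentiableAt
      (fun p hp => B4Green244.differentiableAt_Gfull n hn a m2 ha hm w p hp) (-y)
  rw [B4Green244.K_eq, B4Green244.K_eq, ← latticeKernel_sub (-y) (hint _) (hint _)]
  have h1 : (fun P => B4Green244.Gfull n a m2 (w + B4Green244.e μ) P - B4Green244.Gfull n a m2 w P)
      = fun P => ((n : ℂ))⁻¹ * GDfull n a m2 w μ P := funext fun P => Gfull_add_e_sub n a m2 w μ P
  rw [h1, latticeKernel_const_mul]

/-- **THE HÖLDER IDENTIFICATION (position space).**  For `n ≥ 1`, `a > 0`, `m² ≥ 0`, every fine base point `z`, fine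
displacement `σ`, unit label `y`, direction `μ` and exponent `α`:
`(n/|σ|_∞)^α · n·[(K(z+σ+e_μ,y) − K(z+σ,y)) − (K(z+e_μ,y) − K(z,y))] = latticeKernel GH_{α,n,a,m²,z mod n,μ,σ} (⌊z/n⌋ − y)`,
i.e. with `x = ξz`, `x′ = x + ξσ`: `|x′−x|_∞^{−α}[(∂^ξ_μ G_jQ_j^*)(x′,y) − (∂^ξ_μ G_jQ_j^*)(x,y)]
= (2π)^{-(d+1)}∫ GH(p′)e^{ip′·(x⁰−y)}dp′` — the DICTIONARY sentence of `B4StripSumsHolder.GH`'s docstring, now a theorem.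
[cite: Balaban1983RegularityDecay, (2.36) p. 582, p. 573, (2.49) p. 585; dictionary] -/
theorem K_holder_dd (n : ℕ) [NeZero n] (hn : 1 ≤ n) (a m2 : ℝ) (ha : 0 < a) (hm : 0 ≤ m2) (α : ℝ)
    (z σ y : Fin (d + 1) → ℤ) (μ : Fin (d + 1)) :
    ((((n : ℝ) / supNorm σ) ^ α : ℝ) : ℂ) * ((n : ℂ) *
        ((B4Green244.K n a m2 (z + σ + B4Green244.e μ) y - B4Green244.K n a m2 (z + σ) y)
          - (B4Green244.K n a m2 (z + B4Green244.e μ) y - B4Green244.K n a m2 z y)))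
      = latticeKernel (GH α n a m2 (B4Green244.offset n z) μ σ) (B4Green244.coarse n z - y) := by
  have hnC : (n : ℂ) ≠ 0 := Nat.cast_ne_zero.2 (NeZero.ne n)
  have hintD : ∀ w : Fin (d + 1) → ℤ, IntegrableOn (integrand (GDfull n a m2 w μ) (-y)) (BZ (d + 1)) := fun w =>
    B4Green244.integrableOn_of_differentiableAt
      (fun p hp => differentiableAt_GDfull n hn a m2 ha hm w μ p hp) (-y)
  rw [K_add_e_sub_GDfull n hn a m2 ha hm (z + σ) y μ, K_add_e_sub_GDfull n hn a m2 ha hm z y μ, ← mul_sub,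
    ← latticeKernel_sub (-y) (hintD _) (hintD _)]
  have h2 : (fun P => GDfull n a m2 (z + σ) μ P - GDfull n a m2 z μ P) = GHfull n a m2 z μ σ :=
    funext fun P => GDfull_add_sub n a m2 z σ μ P
  rw [h2, ← mul_assoc (n : ℂ), mul_inv_cancel₀ hnC, one_mul, ← latticeKernel_const_mul]
  have h4 : (fun P => ((((n : ℝ) / supNorm σ) ^ α : ℝ) : ℂ) * GHfull n a m2 z μ σ P)
      = fun P => cexp (I * B4Green244.phaseC P (B4Green244.coarse n z)) * GH α n a m2 (B4Green244.offset n z) μ σ P := by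
    funext P
    rw [← GH_scaled_finePt, B4Green244.finePt_coarse_offset]
  rw [h4, B4Green244.latticeKernel_phase_mul, neg_add_eq_sub]

/-- **(2.36) AT THE KERNEL LEVEL — BOTH ONE-SIDED FINE STEPS, NEAR DISPLACEMENTS.**  For `0 ≤ α < 1` there are `κ > 0`,
`M ≥ 0`, depending only on `d`, `a₋ > 0`, `a₊`, `m²₊`, `α`, such that for every scale `n = L^j ≥ 1`, `a ∈ [a₋, a₊]`,
`m² ∈ [0, m²₊]`, direction `μ`, fine displacement `σ ≠ 0` with `|σ_ν| ≤ n` (i.e. `0 < |x′−x|_∞ ≤ 1`), fine base point `z`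
and unit label `y`:
`(n/|σ|_∞)^α ‖n·[(K(z+σ±e_μ,y) − K(z+σ,y)) − (K(z±e_μ,y) − K(z,y))]‖ ≤ M e^{−κ|⌊z/n⌋ − y|_∞}`, i.e.
`|x−x′|_∞^{−α}|(∂^ξ_μ G_jQ_j^*)(x,y) − (∂^ξ_μ G_jQ_j^*)(x′,y)| ≤ c₁e^{−δ₀|x⁰−y|_∞}` for the forward and the backward
difference derivative — `B4StripSumsHolder.hkernel248_decay` read through `K_holder_dd` (backward step: base point
`z − e_μ`, absorbed into `M` as a factor `e^{κ}` by `supNorm_coarse_add_e_sub_le`).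
[cite: Balaban1983RegularityDecay, Lemma 2.4 (2.36) p. 582, p. 573, (2.49)–(2.51) pp. 585–586] -/
theorem K_holder_decay (d : ℕ) (aminus aplus m2plus : ℝ) (ha : 0 < aminus) {α : ℝ} (hα0 : 0 ≤ α) (hα1 : α < 1) :
    ∃ κ M : ℝ, 0 < κ ∧ 0 ≤ M ∧ ∀ (n : ℕ) [NeZero n] (a m2 : ℝ), aminus ≤ a → a ≤ aplus → 0 ≤ m2 →
      m2 ≤ m2plus → ∀ (μ : Fin (d + 1)) (σ : Fin (d + 1) → ℤ), σ ≠ 0 → (∀ ν, |σ ν| ≤ n) →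
      ∀ (z y : Fin (d + 1) → ℤ),
        ‖((((n : ℝ) / supNorm σ) ^ α : ℝ) : ℂ) * ((n : ℂ) *
            ((B4Green244.K n a m2 (z + σ + Pi.single μ 1) y - B4Green244.K n a m2 (z + σ) y)
              - (B4Green244.K n a m2 (z + Pi.single μ 1) y - B4Green244.K n a m2 z y)))‖
            ≤ M * Real.exp (-(κ * supNorm (B4Green244.coarse n z - y))) ∧
        ‖((((n : ℝ) / supNorm σ) ^ α : ℝ) : ℂ) * ((n : ℂ) *
            ((B4Green244.K n a m2 (z + σ + Pi.single μ (-1)) y - B4Green244.K n a m2 (z + σ) y)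
              - (B4Green244.K n a m2 (z + Pi.single μ (-1)) y - B4Green244.K n a m2 z y)))‖
            ≤ M * Real.exp (-(κ * supNorm (B4Green244.coarse n z - y))) := by
  obtain ⟨κ, M, hκ, hM, h⟩ := B4StripSumsHolder.hkernel248_decay d aminus aplus m2plus ha hα0 hα1
  refine ⟨κ, M * Real.exp κ, hκ, by positivity, ?_⟩
  intro n _ a m2 h1 h2 h3 h4 μ σ hσ0 hσn z y
  have hn : 1 ≤ n := Nat.one_le_iff_ne_zero.2 (NeZero.ne n)
  have ha' : 0 < a := lt_of_lt_of_le ha h1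
  have fwd : ∀ w : Fin (d + 1) → ℤ,
      ‖((((n : ℝ) / supNorm σ) ^ α : ℝ) : ℂ) * ((n : ℂ) *
          ((B4Green244.K n a m2 (w + σ + B4Green244.e μ) y - B4Green244.K n a m2 (w + σ) y)
            - (B4Green244.K n a m2 (w + B4Green244.e μ) y - B4Green244.K n a m2 w y)))‖
        ≤ M * Real.exp (-(κ * supNorm (B4Green244.coarse n w - y))) := by
    intro w
    rw [K_holder_dd n hn a m2 ha' h3 α w σ y μ]
    exact h n a m2 h1 h2 h3 h4 _ μ σ hσ0 hσn _
  have hM1 : M ≤ M * Real.exp κ := le_mul_of_one_le_right hM (Real.one_le_exp hκ.le)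
  constructor
  · exact (fwd z).trans (mul_le_mul_of_nonneg_right hM1 (Real.exp_pos _).le)
  · obtain ⟨w, rfl⟩ : ∃ w, z = w + B4Green244.e μ := ⟨z - B4Green244.e μ, (sub_add_cancel _ _).symm⟩
    have hw : w + B4Green244.e μ + Pi.single μ (-1) = w := by
      rw [add_assoc, B4Green244.e, ← Pi.single_add, add_neg_cancel, Pi.single_zero, add_zero]
    have hw' : w + B4Green244.e μ + σ + Pi.single μ (-1) = w + σ := by
      rw [add_right_comm w, add_assoc (w + σ), B4Green244.e, ← Pi.single_add, add_neg_cancel, Pi.single_zero,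
        add_zero]
    rw [hw', hw, add_right_comm w (B4Green244.e μ) σ]
    have e1 : ((((n : ℝ) / supNorm σ) ^ α : ℝ) : ℂ) * ((n : ℂ) *
          ((B4Green244.K n a m2 (w + σ) y - B4Green244.K n a m2 (w + σ + B4Green244.e μ) y)
            - (B4Green244.K n a m2 w y - B4Green244.K n a m2 (w + B4Green244.e μ) y)))
        = -(((((n : ℝ) / supNorm σ) ^ α : ℝ) : ℂ) * ((n : ℂ) *
          ((B4Green244.K n a m2 (w + σ + B4Green244.e μ) y - B4Green244.K n a m2 (w + σ) y)
            - (B4Green244.K n a m2 (w + B4Green244.e μ) y - B4Green244.K n a m2 w y)))) := by ring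
    rw [e1, norm_neg]
    refine (fwd w).trans ?_
    have hs : supNorm (B4Green244.coarse n (w + B4Green244.e μ) - y) ≤ supNorm (B4Green244.coarse n w - y) + 1 := by
      have h' := supNorm_add_le (B4Green244.coarse n w - y)
        (B4Green244.coarse n (w + B4Green244.e μ) - B4Green244.coarse n w)
      rw [show B4Green244.coarse n w - y + (B4Green244.coarse n (w + B4Green244.e μ) - B4Green244.coarse n w)
          = B4Green244.coarse n (w + B4Green244.e μ) - y by abel] at h'
      linarith [supNorm_coarse_add_e_sub_le n hn w μ]
    rw [mul_assoc, ← Real.exp_add]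
    refine mul_le_mul_of_nonneg_left (Real.exp_le_exp.2 ?_) hM
    have := mul_le_mul_of_nonneg_left hs hκ.le
    linarith

/-! #### (2.36) for `G_j(□)Q_j^*`: images on the source variable, and the display -/

/-- the sign flips preserve the sup norm. [folklore] -/
theorem supNorm_sflip (ε : Fin (d + 1) → Bool) (v : Fin (d + 1) → ℤ) : supNorm (sflip ε v) = supNorm v := by
  unfold supNorm
  congr 1
  funext i
  simp only [sflip_apply]
  split_ifs
  · rw [abs_neg]
  · rfl

/-- the sign flips act coordinatewise up to sign: `|(sflip ε v)_i| = |v_i|`. [folklore] -/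
theorem abs_sflip_apply (ε : Fin (d + 1) → Bool) (v : Fin (d + 1) → ℤ) (i : Fin (d + 1)) :
    |sflip ε v i| = |v i| := by
  simp only [sflip_apply]
  split_ifs
  · exact abs_neg _
  · rfl

/-- the sign flip of `0` is `0`. [folklore] -/
theorem sflip_zero (ε : Fin (d + 1) → Bool) : sflip ε 0 = 0 := by
  funext i
  simp only [sflip_apply, Pi.zero_apply, neg_zero, ite_self]

/-- the sign flips fix only `0`: `v ≠ 0 → sflip ε v ≠ 0`. [folklore] -/
theorem sflip_ne_zero (ε : Fin (d + 1) → Bool) {v : Fin (d + 1) → ℤ} (hv : v ≠ 0) : sflip ε v ≠ 0 :=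
  fun h => hv (by rw [← sflip_sflip ε v, h, sflip_zero])

/-- **(2.36), FOR `G_j(□)Q_j^*` — FROM (α), (β′) AND THE SECOND-DIFFERENCE BOUND ON `K` ONLY (images on the source
variable).**  Box of `N_ν = b·M_ν` fine sites; `K(u,y)` with (α) `Σ_{z ∈ opSupp b u} opK(u,z)K(z,y) = 1_{blk u = y}`,
(β′) `‖K(u,y)‖ ≤ M_K e^{−κ₀|blk u − y|_∞}`, and, for a fixed fine displacement `v`, (δ) the mixed second-difference bound
`‖(K(u + sflip ε v ± e_μ, y) − K(u + sflip ε v, y)) − (K(u ± e_μ, y) − K(u, y))‖ ≤ M_H e^{−κ₀|blk u − y|_∞}` for every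
sign pattern `ε` (an image map `σ_{ε,m}` carries the pair `x, x′ = x + v` to `σx, σx + sflip ε v` and flips `e_μ` on
the reflected coordinate; `reflBox_sub`, `reflBox_add_single`); `GB` ANY inverse of the Neumann box operator.  Then for
fine box points `x`, `x + e_μ`, `x′ = x + v`, `x′ + e_μ` and every unit label `y` of the unit box
`‖Σ_{x″ ∈ □, blk x″ = y} [(GB(x′+e_μ,x″) − GB(x′,x″)) − (GB(x+e_μ,x″) − GB(x,x″))]‖ ≤ M_H · boxConst κ₀ d M ·
e^{−(κ₀/(d+1))|blk x − y|_∞}` — by `greenBoxQ_srcImages` (four times) the left side is the source image series of the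
second difference, majorised image by image (`tsum_srcMajorant_unif`).
[cite: Balaban1983RegularityDecay, p. 582 Lemma 2.4 (2.36), p. 584 (2.42), dictionary] [folklore] -/
theorem greenBoxQ_holder_src {b : ℕ} (hb : 1 ≤ b) {M : Fin (d + 1) → ℕ} (hM : ∀ i, 1 ≤ M i)
    (hN : ∀ i, 1 ≤ (fun i => b * M i) i) (c₁ msq a : ℂ) {K : (Fin (d + 1) → ℤ) → (Fin (d + 1) → ℤ) → ℂ}
    {κ₀ MK MH : ℝ} (hκ₀ : 0 < κ₀) (hMK : 0 ≤ MK) (hMH : 0 ≤ MH)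
    (hDK : ∀ u y, ∑ z ∈ opSupp b u, opK c₁ msq a b u z * K z y = if blk b u = y then 1 else 0)
    (hKdec : ∀ u y, ‖K u y‖ ≤ MK * Real.exp (-(κ₀ * supNorm (blk b u - y))))
    (μ : Fin (d + 1)) (v : Fin (d + 1) → ℤ)
    (hKhol : ∀ (ε : Fin (d + 1) → Bool) (u y : Fin (d + 1) → ℤ),
      ‖(K (u + sflip ε v + Pi.single μ 1) y - K (u + sflip ε v) y) - (K (u + Pi.single μ 1) y - K u y)‖
          ≤ MH * Real.exp (-(κ₀ * supNorm (blk b u - y))) ∧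
      ‖(K (u + sflip ε v + Pi.single μ (-1)) y - K (u + sflip ε v) y) - (K (u + Pi.single μ (-1)) y - K u y)‖
          ≤ MH * Real.exp (-(κ₀ * supNorm (blk b u - y))))
    (GB : Matrix ↥(boxDom (fun i => b * M i)) ↥(boxDom (fun i => b * M i)) ℂ)
    (hGB : (Matrix.of fun x y : ↥(boxDom (fun i => b * M i)) => opBoxK c₁ msq a b (fun i => b * M i) x.1 y.1) * GB = 1)
    (x xe x' xe' : ↥(boxDom (fun i => b * M i))) (hxe : xe.1 = x.1 + Pi.single μ 1) (hx' : x'.1 = x.1 + v)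
    (hxe' : xe'.1 = x'.1 + Pi.single μ 1) {y : Fin (d + 1) → ℤ} (hy : y ∈ boxDom M) :
    ‖∑ x'' : ↥(boxDom (fun i => b * M i)),
        (if blk b x''.1 = y then (GB xe' x'' - GB x' x'') - (GB xe x'' - GB x x'') else 0)‖
      ≤ MH * boxConst κ₀ d M * Real.exp (-(κ₀ / (d + 1) * supNorm (blk b x.1 - y))) := by
  classical
  have hβ : ∀ u, u ∈ boxDom (fun i => b * M i) →
      Summable (fun p : (Fin (d + 1) → Bool) × (Fin (d + 1) → ℤ) => K (reflBox (fun i => b * M i) p.1 p.2 u) y) :=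
    fun u hu => (norm_srcImages_le hb hM hκ₀ hMK hy (fun u' => hKdec u' y) hu).1
  have hsplit : ∑ x'' : ↥(boxDom (fun i => b * M i)),
        (if blk b x''.1 = y then (GB xe' x'' - GB x' x'') - (GB xe x'' - GB x x'') else 0)
      = (∑ x'' : ↥(boxDom (fun i => b * M i)), (if blk b x''.1 = y then GB xe' x'' else 0)
          - ∑ x'' : ↥(boxDom (fun i => b * M i)), (if blk b x''.1 = y then GB x' x'' else 0))
        - (∑ x'' : ↥(boxDom (fun i => b * M i)), (if blk b x''.1 = y then GB xe x'' else 0)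
          - ∑ x'' : ↥(boxDom (fun i => b * M i)), (if blk b x''.1 = y then GB x x'' else 0)) := by
    rw [← Finset.sum_sub_distrib, ← Finset.sum_sub_distrib, ← Finset.sum_sub_distrib]
    refine Finset.sum_congr rfl fun x'' _ => ?_
    split_ifs <;> simp
  rw [hsplit, greenBoxQ_srcImages hb hN c₁ msq a hy (fun u => hDK u y) hβ GB hGB xe',
    greenBoxQ_srcImages hb hN c₁ msq a hy (fun u => hDK u y) hβ GB hGB x',
    greenBoxQ_srcImages hb hN c₁ msq a hy (fun u => hDK u y) hβ GB hGB xe,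
    greenBoxQ_srcImages hb hN c₁ msq a hy (fun u => hDK u y) hβ GB hGB x,
    ← Summable.tsum_sub (hβ _ xe'.2) (hβ _ x'.2), ← Summable.tsum_sub (hβ _ xe.2) (hβ _ x.2),
    ← Summable.tsum_sub ((hβ _ xe'.2).sub (hβ _ x'.2)) ((hβ _ xe.2).sub (hβ _ x.2))]
  -- the images of `x′ = x + v`: `σ_{ε,m} x′ = σ_{ε,m} x + sflip ε v`
  have hv' : ∀ p : (Fin (d + 1) → Bool) × (Fin (d + 1) → ℤ),
      reflBox (fun i => b * M i) p.1 p.2 x'.1 = reflBox (fun i => b * M i) p.1 p.2 x.1 + sflip p.1 v := fun p => by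
    rw [hx', ← sub_eq_iff_eq_add', reflBox_sub, add_sub_cancel_left]
  -- pointwise along the images: the second-difference kernel at `σx`, displacement `sflip ε v`, step `± e_μ`
  have hpt : ∀ p : (Fin (d + 1) → Bool) × (Fin (d + 1) → ℤ),
      ‖(K (reflBox (fun i => b * M i) p.1 p.2 xe'.1) y - K (reflBox (fun i => b * M i) p.1 p.2 x'.1) y)
          - (K (reflBox (fun i => b * M i) p.1 p.2 xe.1) y - K (reflBox (fun i => b * M i) p.1 p.2 x.1) y)‖
        ≤ MH * Real.exp (-(κ₀ * supNorm (reflBox M p.1 p.2 (blk b x.1) - y))) := by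
    intro p
    rw [hxe', hxe, reflBox_add_single, reflBox_add_single, hv' p, ← blk_reflBox_mul hb M p.1 p.2 x.1]
    split_ifs
    · exact (hKhol p.1 _ y).2
    · exact (hKhol p.1 _ y).1
  obtain ⟨hs, hle⟩ := tsum_srcMajorant_unif hM hκ₀ hMH (blk_mem_boxDom hb x.2) hy
  have hs' : Summable (fun p : (Fin (d + 1) → Bool) × (Fin (d + 1) → ℤ) =>
      ‖(K (reflBox (fun i => b * M i) p.1 p.2 xe'.1) y - K (reflBox (fun i => b * M i) p.1 p.2 x'.1) y)
          - (K (reflBox (fun i => b * M i) p.1 p.2 xe.1) y - K (reflBox (fun i => b * M i) p.1 p.2 x.1) y)‖) :=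
    Summable.of_nonneg_of_le (fun _ => norm_nonneg _) hpt hs
  calc ‖∑' p : (Fin (d + 1) → Bool) × (Fin (d + 1) → ℤ),
        ((K (reflBox (fun i => b * M i) p.1 p.2 xe'.1) y - K (reflBox (fun i => b * M i) p.1 p.2 x'.1) y)
          - (K (reflBox (fun i => b * M i) p.1 p.2 xe.1) y - K (reflBox (fun i => b * M i) p.1 p.2 x.1) y))‖
      ≤ ∑' p : (Fin (d + 1) → Bool) × (Fin (d + 1) → ℤ),
          ‖(K (reflBox (fun i => b * M i) p.1 p.2 xe'.1) y - K (reflBox (fun i => b * M i) p.1 p.2 x'.1) y)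
            - (K (reflBox (fun i => b * M i) p.1 p.2 xe.1) y - K (reflBox (fun i => b * M i) p.1 p.2 x.1) y)‖ :=
        norm_tsum_le_tsum_norm hs'
    _ ≤ ∑' p : (Fin (d + 1) → Bool) × (Fin (d + 1) → ℤ),
          MH * Real.exp (-(κ₀ * supNorm (reflBox M p.1 p.2 (blk b x.1) - y))) := Summable.tsum_le_tsum hpt hs' hs
    _ ≤ _ := hle

/-- the uniform constant of the (2.36) display: the near part `C235 d κ₀ M_H` plus twice the (2.35) constant for the
far part. [folklore] -/
def C236 (d : ℕ) (κ₀ MH C₃ : ℝ) : ℝ := C235 d κ₀ MH + 2 * C₃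

/-- **B4 LEMMA 2.4 (2.36) FOR `G_j(□)Q_j^*` (`A = 0`) — THE HÖLDER QUOTIENT OF `∂_μ^{L^{−j}} G_j(□)Q_j^*`, ASSEMBLED FROM
THE TWO AUDITED LINEAGES.**  For `0 ≤ α < 1` there are `κ > 0` and `C ≥ 0`, depending only on `d`, `a₋ > 0`, `a₊`, `m²₊`
and `α`, such that for every fine-lattice scale `n = L^j ≥ 1`, every box `□ = Π_ν [0, n·M_ν)` of fine sites (`M_ν ≥ 1`
unit blocks per direction), every `a ∈ [a₋, a₊]`, `m² ∈ [0, m²₊]`, every inverse `GB` of the Neumann box operator of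
(2.44) (kernel `opBoxK (n²) m² (a·n^{−(d+1)}) n`), every direction `μ`, every two pairs of fine box points `x, x + e_μ` and
`x′, x′ + e_μ` (all four in `□`, `x′ ≠ x`) and every unit label `y ∈ Π_ν [0, M_ν)`:
`(n/|x′ − x|_∞)^α · ‖n · Σ_{x″ ∈ □, blk x″ = y} [(GB(x′+e_μ,x″) − GB(x′,x″)) − (GB(x+e_μ,x″) − GB(x,x″))]‖
≤ C · e^{−κ·min(|blk x − y|_∞, |blk x′ − y|_∞)}` — i.e.
`(1/|x−x′|^α)|(∂_μ^{L^{−j}} G_j(□)Q_j^*)(x,y) − (∂_μ^{L^{−j}} G_j(□)Q_j^*)(x′,y)| ≤ c₁e^{−δ₀dist({x,x′},y)}` with the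
distance `|x − x′|` read in the sup norm of the fine lattice (`= |x′ − x|_∞/n` in lattice units, within `(d+1)^{α/2}`
of the Euclidean one) and `dist({x,x′},y)` read at block resolution as `min(|blk x − y|_∞, |blk x′ − y|_∞)`.  NEAR
PAIRS (`|x′ − x|_∞ ≤ n`, i.e. `|x − x′| ≤ 1`): `green244_kernelForm` ((α)), `B4Green244.K_decay` ((β′)), `K_holder_decay`
((δ), from `B4StripSumsHolder.hkernel248_decay` via `K_holder_dd`; the weight `(n/|sflip ε v|_∞)^α = (n/|v|_∞)^α` is the
same for all images, `supNorm_sflip`) and `greenBoxQ_holder_src`; FAR PAIRS (`|x′ − x|_∞ > n`): the weight is `≤ 1` and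
the two first differences are bounded separately by (2.35), second quantity (`greenBoxQ_deriv_decay_235`), as in the
remark of `B4StripSumsHolder.hkernel248_decay`'s docstring.  The common rate is the minimum of the rates involved; the
existence of `GB` is the only hypothesis (discharged in `greenBoxQ_holder_decay_236_inv`).
[cite: Balaban1983RegularityDecay, p. 582 Lemma 2.4 (2.36) («(1/|x−x′|^α)|(∂_μ^{L^{−j}} G_j(□)Q_j^*)(x, y) −
(∂_μ^{L^{−j}} G_j(□)Q_j^*)(x′, y)| ≤ c₁e^{−δ₀ dist({x,x′},y)}»), p. 573, p. 584 (2.42), (2.44), pp. 585–586 (2.49)–(2.51)] -/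
theorem greenBoxQ_holder_decay_236 (d : ℕ) (aminus aplus m2plus : ℝ) (ha : 0 < aminus) {α : ℝ} (hα0 : 0 ≤ α)
    (hα1 : α < 1) :
    ∃ κ C : ℝ, 0 < κ ∧ 0 ≤ C ∧ ∀ (n : ℕ), 1 ≤ n → ∀ (a m2 : ℝ), aminus ≤ a → a ≤ aplus → 0 ≤ m2 → m2 ≤ m2plus →
      ∀ (M : Fin (d + 1) → ℕ), (∀ i, 1 ≤ M i) →
      ∀ (GB : Matrix ↥(boxDom (fun i => n * M i)) ↥(boxDom (fun i => n * M i)) ℂ),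
        (Matrix.of fun x y : ↥(boxDom (fun i => n * M i)) =>
            opBoxK ((n : ℂ) ^ 2) (m2 : ℂ) ((a : ℂ) * ((n : ℂ) ^ (d + 1))⁻¹) n (fun i => n * M i) x.1 y.1) * GB = 1 →
        ∀ (μ : Fin (d + 1)) (x xe x' xe' : ↥(boxDom (fun i => n * M i))), xe.1 = x.1 + Pi.single μ 1 →
          xe'.1 = x'.1 + Pi.single μ 1 → x'.1 ≠ x.1 →
        ∀ (y : Fin (d + 1) → ℤ), y ∈ boxDom M →
          ((n : ℝ) / supNorm (x'.1 - x.1)) ^ α *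
              ‖(n : ℂ) * ∑ x'' : ↥(boxDom (fun i => n * M i)),
                (if blk n x''.1 = y then (GB xe' x'' - GB x' x'') - (GB xe x'' - GB x x'') else 0)‖
            ≤ C * Real.exp (-(κ * min (supNorm (blk n x.1 - y)) (supNorm (blk n x'.1 - y)))) := by
  obtain ⟨κ₁, MK, hκ₁, hMK, hdec⟩ := B4Green244.K_decay d aminus aplus m2plus ha
  obtain ⟨κ₂, MHc, hκ₂, hMHc, hhol⟩ := K_holder_decay d aminus aplus m2plus ha hα0 hα1
  obtain ⟨κ₃, C₃, hκ₃, hC₃, hfar⟩ := greenBoxQ_deriv_decay_235 d aminus aplus m2plus ha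
  obtain ⟨κ₀, hκ₀1, hκ₀2, hκ₀⟩ : ∃ κ₀, κ₀ ≤ κ₁ ∧ κ₀ ≤ κ₂ ∧ 0 < κ₀ :=
    ⟨min κ₁ κ₂, min_le_left _ _, min_le_right _ _, lt_min hκ₁ hκ₂⟩
  have hC0 : 0 ≤ C235 d κ₀ MHc := C235_nonneg d hκ₀ hMHc
  refine ⟨min (κ₀ / (d + 1)) κ₃, C236 d κ₀ MHc C₃, lt_min (by positivity) hκ₃, by unfold C236; positivity, ?_⟩
  intro n hn a m2 h1 h2 h3 h4 M hM GB hGB μ x xe x' xe' hxe hxe' hne y hy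
  haveI : NeZero n := ⟨by omega⟩
  have ha' : 0 < a := lt_of_lt_of_le ha h1
  have hN : ∀ i, 1 ≤ (fun i => n * M i) i := fun i => Nat.one_le_iff_ne_zero.2 (Nat.mul_ne_zero_iff.2
    ⟨by omega, Nat.one_le_iff_ne_zero.1 (hM i)⟩)
  have hn0 : (0 : ℝ) < n := by exact_mod_cast hn
  -- the displacement `v = x′ − x ≠ 0`
  obtain ⟨v, hv⟩ : ∃ v : Fin (d + 1) → ℤ, x'.1 = x.1 + v := ⟨x'.1 - x.1, (add_sub_cancel _ _).symm⟩
  have hvx : x'.1 - x.1 = v := by rw [hv, add_sub_cancel_left]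
  have hv0 : v ≠ 0 := fun h0 => hne (by rw [hv, h0, add_zero])
  have hsn : 0 < supNorm v := lt_of_lt_of_le one_pos (one_le_supNorm hv0)
  rw [hvx]
  set c : ℝ := ((n : ℝ) / supNorm v) ^ α with hc
  have hc0 : 0 ≤ c := Real.rpow_nonneg (div_nonneg hn0.le hsn.le) α
  -- comparison of the exponential factors with the common one
  have hexp : ∀ {k k' t t' : ℝ}, k ≤ k' → t ≤ t' → 0 ≤ t → 0 ≤ k' →
      Real.exp (-(k' * t')) ≤ Real.exp (-(k * t)) :=
    fun hk ht ht0 hk' => Real.exp_le_exp.2 (neg_le_neg (mul_le_mul hk ht ht0 hk'))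
  have hm0 : 0 ≤ min (supNorm (blk n x.1 - y)) (supNorm (blk n x'.1 - y)) :=
    le_min (supNorm_nonneg _) (supNorm_nonneg _)
  have hE1 : Real.exp (-(κ₀ / (d + 1) * supNorm (blk n x.1 - y)))
      ≤ Real.exp (-(min (κ₀ / (d + 1)) κ₃ * min (supNorm (blk n x.1 - y)) (supNorm (blk n x'.1 - y)))) :=
    hexp (min_le_left _ _) (min_le_left _ _) hm0 (by positivity)
  have hE2 : Real.exp (-(κ₃ * supNorm (blk n x.1 - y)))
      ≤ Real.exp (-(min (κ₀ / (d + 1)) κ₃ * min (supNorm (blk n x.1 - y)) (supNorm (blk n x'.1 - y)))) :=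
    hexp (min_le_right _ _) (min_le_left _ _) hm0 hκ₃.le
  have hE3 : Real.exp (-(κ₃ * supNorm (blk n x'.1 - y)))
      ≤ Real.exp (-(min (κ₀ / (d + 1)) κ₃ * min (supNorm (blk n x.1 - y)) (supNorm (blk n x'.1 - y)))) :=
    hexp (min_le_right _ _) (min_le_right _ _) hm0 hκ₃.le
  set Ecom := Real.exp (-(min (κ₀ / (d + 1)) κ₃ * min (supNorm (blk n x.1 - y)) (supNorm (blk n x'.1 - y))))
    with hEcom
  have hEcom0 : 0 ≤ Ecom := (Real.exp_pos _).le
  by_cases hnear : ∀ ν, |v ν| ≤ n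
  · -- NEAR PAIRS: the Hölder kernel bound through the images
    have hcpos : 0 < c := Real.rpow_pos_of_pos (div_pos hn0 hsn) α
    have hweak : ∀ {κ : ℝ}, κ₀ ≤ κ → ∀ s : ℝ, 0 ≤ s → Real.exp (-(κ * s)) ≤ Real.exp (-(κ₀ * s)) :=
      fun hk s hs => Real.exp_le_exp.2 (neg_le_neg (mul_le_mul_of_nonneg_right hk hs))
    have hKdec : ∀ u w : Fin (d + 1) → ℤ, ‖B4Green244.K n a m2 u w‖
        ≤ MK * Real.exp (-(κ₀ * supNorm (blk n u - w))) :=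
      fun u w => (hdec n a m2 h1 h2 h3 h4 u w).trans
        (mul_le_mul_of_nonneg_left (hweak hκ₀1 _ (supNorm_nonneg _)) hMK)
    have hKhol : ∀ (ε : Fin (d + 1) → Bool) (u w : Fin (d + 1) → ℤ),
        ‖(B4Green244.K n a m2 (u + sflip ε v + Pi.single μ 1) w - B4Green244.K n a m2 (u + sflip ε v) w)
            - (B4Green244.K n a m2 (u + Pi.single μ 1) w - B4Green244.K n a m2 u w)‖
            ≤ MHc / (c * n) * Real.exp (-(κ₀ * supNorm (blk n u - w))) ∧
        ‖(B4Green244.K n a m2 (u + sflip ε v + Pi.single μ (-1)) w - B4Green244.K n a m2 (u + sflip ε v) w)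
            - (B4Green244.K n a m2 (u + Pi.single μ (-1)) w - B4Green244.K n a m2 u w)‖
            ≤ MHc / (c * n) * Real.exp (-(κ₀ * supNorm (blk n u - w))) := by
      intro ε u w
      obtain ⟨hf, hb⟩ := hhol n a m2 h1 h2 h3 h4 μ (sflip ε v) (sflip_ne_zero ε hv0)
        (fun ν => by rw [abs_sflip_apply]; exact hnear ν) u w
      rw [supNorm_sflip, ← hc] at hf hb
      have conv : ∀ {D : ℂ}, ‖((c : ℝ) : ℂ) * ((n : ℂ) * D)‖ ≤ MHc * Real.exp (-(κ₂ * supNorm (blk n u - w))) →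
          ‖D‖ ≤ MHc / (c * n) * Real.exp (-(κ₀ * supNorm (blk n u - w))) := by
        intro D hD
        rw [norm_mul, norm_mul, Complex.norm_real, Complex.norm_natCast, Real.norm_eq_abs, abs_of_nonneg hc0] at hD
        have hD' : c * (n * ‖D‖) ≤ MHc * Real.exp (-(κ₀ * supNorm (blk n u - w))) :=
          hD.trans (mul_le_mul_of_nonneg_left (hweak hκ₀2 _ (supNorm_nonneg _)) hMHc)
        rw [div_mul_eq_mul_div, le_div_iff₀ (mul_pos hcpos hn0)]
        linarith
      exact ⟨conv hf, conv hb⟩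
    have h := greenBoxQ_holder_src hn hM hN ((n : ℂ) ^ 2) (m2 : ℂ) ((a : ℂ) * ((n : ℂ) ^ (d + 1))⁻¹) hκ₀ hMK
      (div_nonneg hMHc (mul_pos hcpos hn0).le) (fun u w => green244_kernelForm n hn a m2 ha' h3 u w) hKdec μ v hKhol
      GB hGB x xe x' xe' hxe hv hxe' hy
    rw [norm_mul, Complex.norm_natCast]
    have h' := mul_le_mul_of_nonneg_left h (mul_pos hcpos hn0).le
    rw [show c * n * (MHc / (c * n) * boxConst κ₀ d M * Real.exp (-(κ₀ / (d + 1) * supNorm (blk n x.1 - y))))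
        = MHc * boxConst κ₀ d M * Real.exp (-(κ₀ / (d + 1) * supNorm (blk n x.1 - y))) by
          field_simp] at h'
    calc c * (n * ‖∑ x'' : ↥(boxDom (fun i => n * M i)),
            (if blk n x''.1 = y then (GB xe' x'' - GB x' x'') - (GB xe x'' - GB x x'') else 0)‖)
        = c * n * ‖∑ x'' : ↥(boxDom (fun i => n * M i)),
            (if blk n x''.1 = y then (GB xe' x'' - GB x' x'') - (GB xe x'' - GB x x'') else 0)‖ := by ring
      _ ≤ MHc * boxConst κ₀ d M * Real.exp (-(κ₀ / (d + 1) * supNorm (blk n x.1 - y))) := h'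
      _ ≤ C235 d κ₀ MHc * Real.exp (-(κ₀ / (d + 1) * supNorm (blk n x.1 - y))) := by
          unfold C235
          exact mul_le_mul_of_nonneg_right (mul_le_mul_of_nonneg_left (boxConst_le_one hκ₀ hM) hMHc)
            (Real.exp_pos _).le
      _ ≤ C235 d κ₀ MHc * Ecom := mul_le_mul_of_nonneg_left hE1 hC0
      _ ≤ C236 d κ₀ MHc C₃ * Ecom := by
          unfold C236
          exact mul_le_mul_of_nonneg_right (le_add_of_nonneg_right (by positivity)) hEcom0
  · -- FAR PAIRS: the weight is `≤ 1`; the two first differences separately by (2.35), second quantity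
    obtain ⟨ν, hν⟩ := not_forall.1 hnear
    have hν' : (n : ℤ) < |v ν| := not_le.1 hν
    have hsup : (n : ℝ) ≤ supNorm v := by
      have h1' : ((n : ℤ) : ℝ) ≤ ((|v ν| : ℤ) : ℝ) := Int.cast_le.2 hν'.le
      rw [Int.cast_natCast] at h1'
      exact h1'.trans (abs_le_supNorm v ν)
    have hc1 : c ≤ 1 := Real.rpow_le_one (div_nonneg hn0.le hsn.le) (div_le_one_of_le₀ hsup hsn.le) hα0
    have hsplit : ∑ x'' : ↥(boxDom (fun i => n * M i)),
          (if blk n x''.1 = y then (GB xe' x'' - GB x' x'') - (GB xe x'' - GB x x'') else 0)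
        = ∑ x'' : ↥(boxDom (fun i => n * M i)), (if blk n x''.1 = y then GB xe' x'' - GB x' x'' else 0)
          - ∑ x'' : ↥(boxDom (fun i => n * M i)), (if blk n x''.1 = y then GB xe x'' - GB x x'' else 0) := by
      rw [← Finset.sum_sub_distrib]
      refine Finset.sum_congr rfl fun x'' _ => ?_
      split_ifs <;> simp
    have hA := hfar n hn a m2 h1 h2 h3 h4 M hM GB hGB μ x' xe' hxe' y hy
    have hB := hfar n hn a m2 h1 h2 h3 h4 M hM GB hGB μ x xe hxe y hy
    rw [hsplit, mul_sub]
    calc c * ‖(n : ℂ) * ∑ x'' : ↥(boxDom (fun i => n * M i)), (if blk n x''.1 = y then GB xe' x'' - GB x' x'' else 0)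
            - (n : ℂ) * ∑ x'' : ↥(boxDom (fun i => n * M i)), (if blk n x''.1 = y then GB xe x'' - GB x x'' else 0)‖
        ≤ 1 * ‖(n : ℂ) * ∑ x'' : ↥(boxDom (fun i => n * M i)), (if blk n x''.1 = y then GB xe' x'' - GB x' x'' else 0)
            - (n : ℂ) * ∑ x'' : ↥(boxDom (fun i => n * M i)), (if blk n x''.1 = y then GB xe x'' - GB x x'' else 0)‖ :=
          mul_le_mul_of_nonneg_right hc1 (norm_nonneg _)
      _ ≤ ‖(n : ℂ) * ∑ x'' : ↥(boxDom (fun i => n * M i)), (if blk n x''.1 = y then GB xe' x'' - GB x' x'' else 0)‖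
            + ‖(n : ℂ) * ∑ x'' : ↥(boxDom (fun i => n * M i)), (if blk n x''.1 = y then GB xe x'' - GB x x'' else 0)‖ := by
          rw [one_mul]; exact norm_sub_le _ _
      _ ≤ C₃ * Real.exp (-(κ₃ * supNorm (blk n x'.1 - y))) + C₃ * Real.exp (-(κ₃ * supNorm (blk n x.1 - y))) :=
          add_le_add hA hB
      _ ≤ C₃ * Ecom + C₃ * Ecom := add_le_add (mul_le_mul_of_nonneg_left hE3 hC₃) (mul_le_mul_of_nonneg_left hE2 hC₃)
      _ = 2 * C₃ * Ecom := by ring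
      _ ≤ C236 d κ₀ MHc C₃ * Ecom := by
          unfold C236
          exact mul_le_mul_of_nonneg_right (le_add_of_nonneg_left hC0) hEcom0

/-- **(2.36) FOR `G_j(□)Q_j^*`, HYPOTHESIS-FREE**: the same bound for the constructed box propagator
`GB := (boxOp n a m2 M)⁻¹` (§4: `boxOp · boxOp⁻¹ = 1` for `n ≥ 1`, `a > 0`, `m² ≥ 0`, `M_ν ≥ 1`).
[cite: Balaban1983RegularityDecay, p. 582 Lemma 2.4 (2.36), p. 573, p. 584 (2.44), pp. 585–586 (2.49)–(2.51)] -/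
theorem greenBoxQ_holder_decay_236_inv (d : ℕ) (aminus aplus m2plus : ℝ) (ha : 0 < aminus) {α : ℝ} (hα0 : 0 ≤ α)
    (hα1 : α < 1) :
    ∃ κ C : ℝ, 0 < κ ∧ 0 ≤ C ∧ ∀ (n : ℕ), 1 ≤ n → ∀ (a m2 : ℝ), aminus ≤ a → a ≤ aplus → 0 ≤ m2 → m2 ≤ m2plus →
      ∀ (M : Fin (d + 1) → ℕ), (∀ i, 1 ≤ M i) →
        boxOp n a m2 M * (boxOp n a m2 M)⁻¹ = 1 ∧
        ∀ (μ : Fin (d + 1)) (x xe x' xe' : ↥(boxDom (fun i => n * M i))), xe.1 = x.1 + Pi.single μ 1 →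
          xe'.1 = x'.1 + Pi.single μ 1 → x'.1 ≠ x.1 →
        ∀ (y : Fin (d + 1) → ℤ), y ∈ boxDom M →
          ((n : ℝ) / supNorm (x'.1 - x.1)) ^ α *
              ‖(n : ℂ) * ∑ x'' : ↥(boxDom (fun i => n * M i)),
                (if blk n x''.1 = y then ((boxOp n a m2 M)⁻¹ xe' x'' - (boxOp n a m2 M)⁻¹ x' x'')
                  - ((boxOp n a m2 M)⁻¹ xe x'' - (boxOp n a m2 M)⁻¹ x x'') else 0)‖
            ≤ C * Real.exp (-(κ * min (supNorm (blk n x.1 - y)) (supNorm (blk n x'.1 - y)))) := by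
  obtain ⟨κ, C, hκ, hC, h⟩ := greenBoxQ_holder_decay_236 d aminus aplus m2plus ha hα0 hα1
  refine ⟨κ, C, hκ, hC, fun n hn a m2 h1 h2 h3 h4 M hM => ?_⟩
  have hinv : boxOp n a m2 M * (boxOp n a m2 M)⁻¹ = 1 := boxOp_mul_inv hn (lt_of_lt_of_le ha h1) h3 hM
  exact ⟨hinv, fun μ x xe x' xe' hxe hxe' hne y hy => h n hn a m2 h1 h2 h3 h4 M hM _ hinv μ x xe x' xe' hxe hxe' hne y hy⟩

end Holder

end

end Literature.MathematicalPhysics.QuantumFieldTheory.Balaban1983to89.B4Green242Bridge
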